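import Literature.Barriers.SmoothPoincare4.SmallExoticaFrontierReduction
import Literature.Topology.FourManifolds.TrisectionFunctorSPC4Proofs
import Literature.AlgebraicTopology.SingularHomology.IntersectionFormProofs
import Literature.AlgebraicTopology.SingularHomology.PairTimesCircle
import Literature.AlgebraicTopology.Homotopy.ManifoldStronglyLocallyContractible
import Literature.Topology.FourManifolds.BordismFourProjectivePlane
import Literature.AlgebraicTopology.FundamentalGroup.VanKampenPushout
import Literature.AlgebraicTopology.FundamentalGroup.SphereSimplyConnected
import Literature.Topology.FourManifolds.TubularSplitting
import Literature.Topology.FourManifolds.BoundaryManifoldHomologyVanishing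
import Literature.Topology.FourManifolds.SignatureCupTrivialPieces
import Mathlib.GroupTheory.Commutator.Basic
import HarnessLib

/-!
# Akhmedov–Park 2010, Lemma 8: the printed proof, formalised up to its two non-classical inputs

Proof file (theorems only) for the Seiberg–Witten leaf
`Literature.Barriers.SmoothPoincare4.akhmedovPark2010_lemma8_invariants`
(`SmallExoticaFrontierReduction.lean`, §2; fact seat `provefact-…SmoothPoincare4.akhm-b683e402a8`,
triage `SIZE: XL`): "The set `S_{1,2} = {X₁(m) | m ≥ 1}` consists of irreducible 4-manifolds that
are homeomorphic to `ℂℙ² # 2ℂℙ²bar`. Moreover, `S_{1,2}` contains an infinite subset consisting of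
pairwise non-diffeomorphic non-symplectic 4-manifolds" (A. Akhmedov, B. D. Park, *Exotic smooth
structures on small 4-manifolds with odd signatures*, Invent. Math. **181** (2010) 577–603, §9,
Lemma 8), where `X₁(m) = Y₁(1,1) #_ψ Z''(1,m)` is the normal connected sum, along genus-2
surfaces `Σ₂ ⊂ Y₁(1,1)` and `Σ̄₂ ⊂ Z''(1,m)`, of the Luttinger-surgered `Σ₂ × T²` and the
torus-surgered `T⁴ # ℂℙ²bar`.

The printed proof has four steps: (a) `e(X₁(m)) = 0 + 1 + 4 = 5`, `σ(X₁(m)) = 0 + (-1) = -1`;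
(b) `π₁(X₁(m)) = 1` by the Seifert–Van Kampen theorem from the surgery presentations (§9 with
Thm. 6 and Lemmas 4, 5 of §§5–8); (c) "From Freedman's theorem … `X₁(m)` is homeomorphic to
`ℂℙ² # 2ℂℙ²bar`" (peeled off in `SmallExoticaFrontierProofs.lean`, not part of the leaf);
(d) "compute the Seiberg–Witten invariants of `X₁(m)` and check that infinitely many of them are
distinct by applying exactly the same argument as in [ABP, FPS] using the product formulas in
[MMS]", whence an infinite pairwise non-diffeomorphic subfamily.  Two inputs are theories absent
from Mathlib and the tree — the smooth normal-connected-sum / torus-surgery CONSTRUCTION of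
`X₁(m)` (with the van Kampen presentations of the two pieces it delivers) and SEIBERG–WITTEN
INVARIANTS (definition, diffeomorphism invariance, product formulas) — so the leaf is not
discharged here.  What this file proves is everything else, i.e. the printed ARGUMENT as
theorems whose hypotheses are exactly what those two inputs must deliver:

* §1 `akhmedovPark2010_lemma8_pi1_generators_eq_one` — **the group theory of step (b)**: in any
  group, elements `a₁ a₂ b₁ b₂ c d` (images of the generators of `π₁(Y₁(1,1) ∖ νΣ₂)`) and
  `α₁ … α₄` (images of the generators of `π₁(Z''(1,m) ∖ νΣ̄₂)`) satisfying the printed relations —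
  the Luttinger relations (§9, display after "The following relations hold in `π₁(Y₁(1/p,1/q))`",
  `p = q = 1`), the relations of Thm. 6 (`q = r = 1`), the gluing `a₁ = α₁, b₁ = α₂, b₂ = α₄`
  (eq. `ψ_*`, Lemma 5) and `a₂ ≡ α₃²` modulo the meridians of `Σ̄₂` (Lemma 4 with the display
  `ā₂ ↦ α₃²` of §3) — are all trivial; the deduction is the paper's, line by line (§9, proof of
  Lemma 8).
* §2 `subsingleton_fundamentalGroup_of_cover_of_normalClosure_eq_top`,
  `simplyConnectedSpace_of_cover_of_normalClosure_eq_top` — **the van Kampen half of step (b)**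
  (from the tree's Seifert–van Kampen theorem, Hatcher Lemma 1.15,
  `Literature.AlgebraicTopology.FundamentalGroup.VanKampen.closure_range_inclHom_union_eq_top`):
  if `X = U ∪ T` (open, `U`, `T`, `U ∩ T` path connected, common base point) and `π₁(U)`, `π₁(T)`
  are normally generated by sets of loops that die in `π₁(X)`, then `π₁(X) = 1` and `X` is simply
  connected.
* §3 `akhmedovPark2010_lemma8_simplyConnectedSpace_of_cover` — **step (b) assembled**: a space
  covered by two such open pieces whose fundamental groups are (normally) generated by elements
  satisfying the printed relations of `Y₁(1,1) ∖ νΣ₂` and `Z''(1,m) ∖ νΣ̄₂`, glued by the printed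
  identifications, is simply connected.  Feeding it the actual pieces of `X₁(m)` is exactly what
  the missing construction must do.
* §4 `akhmedovPark2010_lemma8_invariants_of_infinite_range` — **step (d) ⇒ Lemma 8 as vendored**:
  a family of simply connected closed smooth 4-manifolds with `b₂ = 3`, `σ = -1` on which SOME
  diffeomorphism invariant takes infinitely many values has an infinite pairwise non-diffeomorphic
  subfamily, re-indexed by `ℕ` — i.e. `akhmedovPark2010_lemma8_invariants`.  Feeding it the
  Seiberg–Witten invariant of `X₁(m)` (made diffeomorphism-invariant, e.g. as the multiset of
  absolute values over basic classes) and the [ABP, FPS]/[MMS] computation is exactly what the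
  missing gauge theory must do.

* §5 `finrank_freeCohomology_two_eq_euler_sub_two`,
  `akhmedovPark2010_lemma8_invariants_of_euler_of_infinite_range` — **step (a) as printed**: the
  paper computes the EULER CHARACTERISTIC, "`e(X₁(m)) = 0 + 1 + 4 = 5`", while the leaf records
  `rank H²(X₁(m); ℤ)/T = 3` (its docstring's "stated deviation: `e = 5` is rendered as
  `rank H²/T = 3`, the same number `b₂ = e - 2` for a simply connected closed 4-manifold").  That
  deviation is discharged here: for every simply connected closed topological 4-manifold,
  `rank H²(M; ℤ)/T = rank H₂(M; ℤ) = e(M) - 2` with `e(M) = Σ_{j<5} (-1)ʲ rank H_j(M; ℤ)`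
  (`H₀ ≅ H₄ ≅ ℤ`, `H₁ = 0` by Hurewicz, `H₃ ≅ H¹ = 0` by the tree's PROVED Poincaré duality,
  universal coefficients for the lattice), so the reduction of §4 takes the printed inputs
  `e = 5`, `σ = -1`, `π₁ = 1` verbatim.

* §6 `relEuler_eq_of_compact_cover`, `akhmedovPark2010_lemma8_finrank_eq_three_of_cover` —
  **step (a), the computation** "`e(X₁(m)) = e(Y₁(1,1)) + e(Z''(1,m)) - 2e(Σ₂)`": the Euler
  characteristic of a closed topological 4-manifold cut into two compact locally contractible
  pieces of finite homological type is `χ(K₁) + χ(K₂) - χ(K₁ ∩ K₂)` (rational Čech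
  Mayer–Vietoris + tautness + the ENR theorem, all PROVED in the tree), whence `b₂ = 3` for a
  simply connected `X = K₁ ∪ K₂` with `χ(K₁) + χ(K₂) - χ(K₁ ∩ K₂) = 5` — the shape
  `(Y₁(1,1) ∖ ν°Σ₂) ∪ (Z''(1,m) ∖ ν°Σ̄₂)`, `2 + 3 - 0`, of the normal connected sum.

* §7 `relEuler_eq_sub_of_tubular_cover`,
  `akhmedovPark2010_lemma8_finrank_eq_three_of_cover_circle` — **step (a), the two classical
  summands**: the gluing region `∂νΣ₂ ≅ Σ₂ × S¹` of the normal connected sum has `χ = 0` and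
  finitely generated homology (the tree's PROVED `FinRelHomology.prod_addCircle`,
  `PairTimesCircle.lean`) and is locally contractible (`locallyContractibleSpace_prod_addCircle`,
  `ManifoldStronglyLocallyContractible.lean`), so §6 needs only `χ(K₁) + χ(K₂) = 5`; and a closed
  4-manifold `Y` cut
  into the complement of an open tubular neighbourhood of a surface `Σ` and the closed tubular
  neighbourhood `Σ × D²` has `χ(Y ∖ ν°Σ) = χ(Y) - χ(Σ)` — the printed "`e(Y₁(1,1)) - e(Σ₂)`",
  "`e(Z''(1,m)) - e(Σ̄₂)`", i.e. `e(X₁(m)) = e(Y₁(1,1)) + e(Z''(1,m)) - 2e(Σ₂)`.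

* §8 **step (a), the printed numbers `0`, `1` (and `-2`)**: `e(Y₁(1,1)) = e(Σ₂ × T²) = 0` and
  `e(Z''(1,m)) = e(T⁴ # ℂℙ²bar) = 0 + 3 - 2 = 1` rest on: torus (Luttinger) surgery preserves `e`
  (`relEuler_eq_of_torusSurgery_covers`, from §7 with `χ(T²) = 0`), `e(A # B) = e(A) + e(B) - 2`
  (`relEuler_eq_of_connectedSum_covers`, from §6 with `χ(S³) = 0`, `χ(D⁴) = 1`:
  `finRelHomology_sphere_three`, `relEuler_eq_sub_one_of_punctured_cover`), `e(K × T²) = 0`,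
  `e(T⁴) = 0` (`relEuler_torus_four`; `FinRelHomology.prod_torus` in the tree) and `e(ℂℙ²) = 3`
  (`euler_complexProjectivePlane`, from §5 and the tree's `H²(ℂℙ²; ℤ)/T ≅ ℤ`); only `e(Σ₂) = -2`
  (the genus-2 surface itself) and the decompositions are left to the construction.

* §9 `finRelHomology_and_relEuler_surface`, `relEuler_surface_of_finrank_one_eq_four`,
  `akhmedovPark2010_lemma8_finrank_eq_three_of_cover_surface` — **the last printed number,
  `e(Σ₂) = -2`**: a closed connected `ℤ`-oriented topological surface has `χ = 2 - rank H₁`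
  (fundamental class + `H₀`), so with `rank H₁ = 4` it has `χ = -2`; step (a) of the printed
  proof thereby holds for any decomposition `X = K₁ ∪ K₂`, `K₁ ∩ K₂ ≅ Σ₂ × S¹`, with
  `χ(K₁) + χ(K₂) = 5`, ALL classical inputs (finiteness, local contractibility, `χ(Σ₂ × S¹) = 0`)
  being theorems of the tree — only the construction of `X₁(m)` with this decomposition remains.

Nothing is asserted: no `def … : Prop`, no new named fact; the leaf
`akhmedovPark2010_lemma8_invariants` and its users are untouched.

## References

* [AkhmedovPark2010] A. Akhmedov, B. D. Park, *Exotic smooth structures on small 4-manifolds with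
  odd signatures*, Invent. Math. 181 (2010) 577–603; arXiv:math/0701829, whose numbering is used:
  §3 (display `āᵢ, b̄ᵢ ↦ …`), §6 Lemma 4, §7 Lemma 5, §8 Thm. 6, §9 Lemma 8 and its proof.
* [HatcherAT2002] A. Hatcher, *Algebraic Topology* (2002), Lemma 1.15, Thm. 1.20; for §5:
  Prop. 2.7, Thm. 2A.1, §3.1 Cor. 3.3, Prop. 3.25, Thm. 3.26, Thm. 3.30, §3.A Cor. 3A.6.
* [Kirby1989] R. C. Kirby, *The Topology of 4-Manifolds*, LNM 1374 (1989), Ch. II §1.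
* [Spanier1981] E. H. Spanier, *Algebraic Topology* (1966/1981), Ch. 4 §3 Thm. 14, Ch. 6 §1
  Thm. 10 and Thm. 13 (§6).
* [ABP] A. Akhmedov, R. İ. Baykur, B. D. Park, J. Topol. 1 (2008) 409–428; [FPS] R. Fintushel,
  B. D. Park, R. J. Stern, Algebr. Geom. Topol. 7 (2007) 2103–2116; [MMS] J. W. Morgan,
  T. S. Mrowka, Z. Szabó, Math. Res. Lett. 4 (1997) 915–929 (cited for step (d), not formalised).
-/

noncomputable section

open scoped Manifold ContDiff commutatorElement
open Set
open Literature.AlgebraicTopology.SingularHomology (HomologicalOrientation freeCohomology)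
open Literature.AlgebraicTopology.FundamentalGroup (simplyConnectedSpace_of_loops_nullhomotopic_at)
open Literature.AlgebraicTopology.FundamentalGroup.VanKampen (inclHom
  closure_range_inclHom_union_eq_top)

universe u

namespace Literature.Barriers.SmoothPoincare4

/-! ### §1 Step (b), the group theory: the printed relations kill every generator -/

/-- **Akhmedov–Park 2010, proof of Lemma 8, the fundamental-group computation (group-theoretic
content).** In a group `G` (in the paper: `π₁(X₁(m))`, a quotient of
`π₁(Y₁(1,1) ∖ νΣ₂) ∗ π₁(Z''(1,m) ∖ νΣ̄₂)`), let `a₁ a₂ b₁ b₂ c d` and `α₁ α₂ α₃ α₄` satisfy: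
the Luttinger relations of `Y₁(1,1)` that survive in the complement of `Σ₂` and are used —
`[b₁⁻¹, d⁻¹] = a₁`, `[a₁⁻¹, d] = b₁`, `[d⁻¹, b₂⁻¹] = c`, `[c⁻¹, b₂] = d`, `[b₁, c] = 1` (§9; the
printed list also has `[a₁, c] = [a₂, c] = [a₂, d] = 1` and `[a₁, b₁][a₂, b₂] = 1`, not needed);
the relations of Thm. 6 with `q = r = 1` — `α₃ = [α₁⁻¹, α₄⁻¹]`, `α₄ = [α₁^{ε₁}, α₃^{ε₃}]^m`
("it will be enough to know only that `α₄^r = [α₁^{ε₁}, α₃^{ε₃}]^m` holds with `ε₁, ε₃ ∈ {±1}`";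
here any integers), `[α₂, α₄] = 1` (also `[α₂, α₃] = 1`, not needed); the gluing
`a₁ = α₁, b₁ = α₂, b₂ = α₄` (`ψ_*`, eq. before Lemma 8, with Lemma 5); and `a₂ = α₃² · t` for some
`t` in the normal closure of the meridian `[α₃, α₄]` of `Σ̄₂` (Lemma 4 with the display of §3:
`ā₂ ↦ α₃²` in `π₁(Z'')`, whose kernel from the complement is normally generated by the meridian,
Thm. 6).  **Then all ten elements are trivial** — verbatim the printed deduction: `[b₁, b₂] = 1`
from `[α₂, α₄] = 1`; with `[b₁, c] = 1`, `b₁` commutes with `d = [c⁻¹, b₂]`, so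
`a₁ = [b₁⁻¹, d⁻¹] = 1`; then `b₁ = [a₁⁻¹, d] = 1`, `α₁ = α₂ = 1`; plugging `α₁ = 1` into Thm. 6,
`α₃ = α₄ = 1`, so the meridian `[α₃, α₄]` and its normal closure die; `b₂ = α₄ = 1`, whence
`c = d = 1`; finally `a₂ = α₃² = 1`. [cite: AkhmedovPark2010, §9, proof of Lemma 8 (with Thm. 6, Lemmas 4–5)] -/
theorem akhmedovPark2010_lemma8_pi1_generators_eq_one {G : Type*} [Group G]
    {a₁ a₂ b₁ b₂ c d α₁ α₂ α₃ α₄ : G} {m ε₁ ε₃ : ℤ}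
    (hY₁ : ⁅b₁⁻¹, d⁻¹⁆ = a₁) (hY₂ : ⁅a₁⁻¹, d⁆ = b₁) (hY₃ : ⁅d⁻¹, b₂⁻¹⁆ = c) (hY₄ : ⁅c⁻¹, b₂⁆ = d)
    (hY₅ : ⁅b₁, c⁆ = 1)
    (hZ₁ : α₃ = ⁅α₁⁻¹, α₄⁻¹⁆) (hZ₂ : α₄ = ⁅α₁ ^ ε₁, α₃ ^ ε₃⁆ ^ m) (hZ₃ : ⁅α₂, α₄⁆ = 1)
    (hψ₁ : a₁ = α₁) (hψ₂ : b₁ = α₂) (hψ₃ : b₂ = α₄)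
    (ha₂ : ∃ t ∈ Subgroup.normalClosure ({⁅α₃, α₄⁆} : Set G), a₂ = α₃ ^ 2 * t) :
    a₁ = 1 ∧ a₂ = 1 ∧ b₁ = 1 ∧ b₂ = 1 ∧ c = 1 ∧ d = 1 ∧ α₁ = 1 ∧ α₂ = 1 ∧ α₃ = 1 ∧ α₄ = 1 := by
  -- `[b₁, b₂] = 1` from `[α₂, α₄] = 1` and the gluing
  have hb₁b₂ : Commute b₁ b₂ := by
    rw [hψ₂, hψ₃]
    exact commutatorElement_eq_one_iff_commute.1 hZ₃
  have hb₁c : Commute b₁ c := commutatorElement_eq_one_iff_commute.1 hY₅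
  -- hence `b₁` commutes with `d = [c⁻¹, b₂]`, and `a₁ = [b₁⁻¹, d⁻¹] = 1`
  have hb₁d : Commute b₁ d := by
    rw [← hY₄, commutatorElement_def]
    exact ((hb₁c.inv_right.mul_right hb₁b₂).mul_right hb₁c.inv_right.inv_right).mul_right
      hb₁b₂.inv_right
  have ha₁ : a₁ = 1 := by
    rw [← hY₁]
    exact commutatorElement_eq_one_iff_commute.2 hb₁d.inv_left.inv_right
  -- `b₁ = [a₁⁻¹, d] = 1`, `α₁ = a₁ = 1`, `α₂ = b₁ = 1`
  have hb₁ : b₁ = 1 := by rw [← hY₂, ha₁, inv_one, commutatorElement_one_left]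
  have hα₁ : α₁ = 1 := hψ₁ ▸ ha₁
  have hα₂ : α₂ = 1 := hψ₂ ▸ hb₁
  -- Thm. 6 with `α₁ = 1`: `α₃ = α₄ = 1`
  have hα₃ : α₃ = 1 := by rw [hZ₁, hα₁, inv_one, commutatorElement_one_left]
  have hα₄ : α₄ = 1 := by rw [hZ₂, hα₁, one_zpow, commutatorElement_one_left, one_zpow]
  -- `b₂ = α₄ = 1`, then `c = [d⁻¹, b₂⁻¹] = 1`, `d = [c⁻¹, b₂] = 1`
  have hb₂ : b₂ = 1 := hψ₃.trans hα₄
  have hc : c = 1 := by rw [← hY₃, hb₂, inv_one, commutatorElement_one_right]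
  have hd : d = 1 := by rw [← hY₄, hb₂, commutatorElement_one_right]
  -- the meridian `[α₃, α₄]` dies, hence its normal closure, hence `a₂ = α₃² = 1`
  have hN : Subgroup.normalClosure ({⁅α₃, α₄⁆} : Set G) = ⊥ := by
    rw [Subgroup.normalClosure_eq_bot_iff, hα₃, hα₄, commutatorElement_one_right]
  have ha₂' : a₂ = 1 := by
    obtain ⟨t, ht, rfl⟩ := ha₂
    rw [hN, Subgroup.mem_bot] at ht
    rw [ht, hα₃, one_pow, one_mul]
  exact ⟨ha₁, ha₂', hb₁, hb₂, hc, hd, hα₁, hα₂, hα₃, hα₄⟩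

/-! ### §2 Step (b), the van Kampen half: pieces normally generated by loops dying in `X` -/

/-- **If `X = U ∪ T` with `U`, `T` open, `x₀ ∈ U ∩ T`, `U`, `T`, `U ∩ T` path connected, and
`π₁(U, x₀)`, `π₁(T, x₀)` are the normal closures of sets `A`, `B` whose images in `π₁(X, x₀)` are
trivial, then `π₁(X, x₀)` is trivial.**  By Hatcher's Lemma 1.15 (the tree's
`closure_range_inclHom_union_eq_top`) `π₁(X, x₀)` is generated by the images of `π₁(U)` and
`π₁(T)`; each inclusion homomorphism kills `A` resp. `B`, hence (kernels being normal) their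
normal closures, i.e. everything.  This is the form in which the paper uses "From Seifert–Van
Kampen theorem, we can deduce that `π₁(X₁(m))` is a quotient of [the amalgam]" together with
"`π₁(Y₁(1,1) ∖ νΣ₂, z₁)` is normally generated by `aᵢ, bᵢ` (`i = 1, 2`) and `c, d`".
[cite: HatcherAT2002, Lemma 1.15] [cite: AkhmedovPark2010, §9, proof of Lemma 8] -/
theorem subsingleton_fundamentalGroup_of_cover_of_normalClosure_eq_top
    {X : Type*} [TopologicalSpace X] {U T : Set X} {x₀ : X}
    (hUo : IsOpen U) (hTo : IsOpen T) (hcov : U ∪ T = univ) (hxU : x₀ ∈ U) (hxT : x₀ ∈ T)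
    (hUpc : IsPathConnected U) (hTpc : IsPathConnected T) (hmeet : IsPathConnected (U ∩ T))
    {A : Set (FundamentalGroup U ⟨x₀, hxU⟩)} {B : Set (FundamentalGroup T ⟨x₀, hxT⟩)}
    (hA : Subgroup.normalClosure A = ⊤) (hB : Subgroup.normalClosure B = ⊤)
    (hA₁ : ∀ a ∈ A, inclHom U x₀ hxU a = 1) (hB₁ : ∀ b ∈ B, inclHom T x₀ hxT b = 1) :
    Subsingleton (FundamentalGroup X x₀) := by
  have hkU : ∀ a, inclHom U x₀ hxU a = 1 := by
    have hle : Subgroup.normalClosure A ≤ (inclHom U x₀ hxU).ker :=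
      Subgroup.normalClosure_le_normal fun a ha => MonoidHom.mem_ker.2 (hA₁ a ha)
    rw [hA] at hle
    exact fun a => MonoidHom.mem_ker.1 (hle (Subgroup.mem_top a))
  have hkT : ∀ b, inclHom T x₀ hxT b = 1 := by
    have hle : Subgroup.normalClosure B ≤ (inclHom T x₀ hxT).ker :=
      Subgroup.normalClosure_le_normal fun b hb => MonoidHom.mem_ker.2 (hB₁ b hb)
    rw [hB] at hle
    exact fun b => MonoidHom.mem_ker.1 (hle (Subgroup.mem_top b))
  have key : Subgroup.closure (range (inclHom U x₀ hxU) ∪ range (inclHom T x₀ hxT)) ≤ ⊥ := by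
    rw [Subgroup.closure_le]
    rintro g (⟨a, rfl⟩ | ⟨b, rfl⟩)
    · rw [hkU a]
      exact Subgroup.mem_bot.2 rfl
    · rw [hkT b]
      exact Subgroup.mem_bot.2 rfl
  rw [closure_range_inclHom_union_eq_top hUo hTo hcov hxU hxT hUpc hTpc hmeet, top_le_iff] at key
  refine subsingleton_of_forall_eq 1 fun g => ?_
  have hg : g ∈ (⊥ : Subgroup (FundamentalGroup X x₀)) := by
    rw [key]
    exact Subgroup.mem_top g
  exact Subgroup.mem_bot.1 hg

/-- **… and then `X` is simply connected** (`X = U ∪ T` is path connected as a union of path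
connected sets with a common point, and one base point suffices).
[cite: HatcherAT2002, Lemma 1.15] [cite: AkhmedovPark2010, §9, proof of Lemma 8] -/
theorem simplyConnectedSpace_of_cover_of_normalClosure_eq_top
    {X : Type*} [TopologicalSpace X] {U T : Set X} {x₀ : X}
    (hUo : IsOpen U) (hTo : IsOpen T) (hcov : U ∪ T = univ) (hxU : x₀ ∈ U) (hxT : x₀ ∈ T)
    (hUpc : IsPathConnected U) (hTpc : IsPathConnected T) (hmeet : IsPathConnected (U ∩ T))
    {A : Set (FundamentalGroup U ⟨x₀, hxU⟩)} {B : Set (FundamentalGroup T ⟨x₀, hxT⟩)}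
    (hA : Subgroup.normalClosure A = ⊤) (hB : Subgroup.normalClosure B = ⊤)
    (hA₁ : ∀ a ∈ A, inclHom U x₀ hxU a = 1) (hB₁ : ∀ b ∈ B, inclHom T x₀ hxT b = 1) :
    SimplyConnectedSpace X := by
  haveI := subsingleton_fundamentalGroup_of_cover_of_normalClosure_eq_top hUo hTo hcov hxU hxT
    hUpc hTpc hmeet hA hB hA₁ hB₁
  haveI : PathConnectedSpace X := by
    rw [pathConnectedSpace_iff_univ, ← hcov]
    exact hUpc.union hTpc ⟨x₀, hxU, hxT⟩
  exact simplyConnectedSpace_of_loops_nullhomotopic_at x₀ fun γ =>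
    Path.Homotopic.Quotient.eq.mp (Subsingleton.elim (α := FundamentalGroup X x₀)
      (Path.Homotopic.Quotient.mk γ) (Path.Homotopic.Quotient.mk (Path.refl x₀)))

/-! ### §3 Step (b) assembled: `π₁(X₁(m)) = 1` for any space glued like `X₁(m)` -/

/-- **Akhmedov–Park 2010, proof of Lemma 8: "`π₁(X₁(m)) = 1`", for any space presented like
`X₁(m)`.**  Let `X = U ∪ T` with `U`, `T` open, `x₀ ∈ U ∩ T` and `U`, `T`, `U ∩ T` path connected
(for `X₁(m)`: open thickenings of `Y₁(1,1) ∖ νΣ₂` and `Z''(1,m) ∖ νΣ̄₂`, meeting in a collar of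
`∂νΣ₂ ≅ Σ₂ × S¹`).  Suppose `π₁(U, x₀)` is normally generated by `a₁, a₂, b₁, b₂, c, d` ("we can
choose the base point `z₁` … such that `π₁(Y₁(1,1) ∖ νΣ₂, z₁)` is normally generated by `aᵢ, bᵢ`
(`i = 1, 2`) and `c, d`") subject to the surviving Luttinger relations `[b₁⁻¹, d⁻¹] = a₁`,
`[a₁⁻¹, d] = b₁`, `[d⁻¹, b₂⁻¹] = c`, `[c⁻¹, b₂] = d`, `[b₁, c] = 1` (§9, `p = q = 1`); that
`π₁(T, x₀)` is normally generated by `α₁, …, α₄` together with a set `S` of elements of the normal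
closure of the meridian `[α₃, α₄]` (Thm. 6: "`π₁(Z''(1/q,m/r) ∖ νΣ̄₂)` is a quotient of
`⟨α₁, α₂, α₃, α₄, g₁, …, g_s | α₃^q = [α₁⁻¹, α₄⁻¹], α₄^r = [α₁, α₃⁻¹]^m, [α₂, α₃] = [α₂, α₄] = 1⟩`
… the images of `g₁, …, g_s` are elements of the subgroup normally generated by the image of
`[α₃, α₄]`", with `q = r = 1` and the sign-agnostic form `α₄ = [α₁^{ε₁}, α₃^{ε₃}]^m`); and that in
`π₁(X, x₀)` the gluing identifies `a₁ = α₁`, `b₁ = α₂`, `b₂ = α₄` (`ψ_*`, Lemma 5) and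
`a₂ = α₃² · t` with `t` in the normal closure of `[α₃, α₄]` (Lemma 4 with the display `ā₂ ↦ α₃²` of §3).  **Then `X` is
simply connected.**  Proof: push the relations into `π₁(X, x₀)`, kill all generators there
(`akhmedovPark2010_lemma8_pi1_generators_eq_one`), and conclude by van Kampen
(`simplyConnectedSpace_of_cover_of_normalClosure_eq_top`); the elements of `S` die with the
meridian.  The two inputs this theorem does not supply — the pieces of `X₁(m)` as such a cover and
their presentations — are the smooth normal-connected-sum / Luttinger-surgery construction of
§§2–4, 9, absent from Mathlib and the tree. [cite: AkhmedovPark2010, §9, proof of Lemma 8 (with Thm. 6, Lemmas 4–5)] [cite: HatcherAT2002, Lemma 1.15] -/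
theorem akhmedovPark2010_lemma8_simplyConnectedSpace_of_cover
    {X : Type*} [TopologicalSpace X] {U T : Set X} {x₀ : X}
    (hUo : IsOpen U) (hTo : IsOpen T) (hcov : U ∪ T = univ) (hxU : x₀ ∈ U) (hxT : x₀ ∈ T)
    (hUpc : IsPathConnected U) (hTpc : IsPathConnected T) (hmeet : IsPathConnected (U ∩ T))
    {a₁ a₂ b₁ b₂ c d : FundamentalGroup U ⟨x₀, hxU⟩}
    {α₁ α₂ α₃ α₄ : FundamentalGroup T ⟨x₀, hxT⟩} {S : Set (FundamentalGroup T ⟨x₀, hxT⟩)}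
    {m ε₁ ε₃ : ℤ}
    (hgenU : Subgroup.normalClosure ({a₁, a₂, b₁, b₂, c, d} : Set (FundamentalGroup U ⟨x₀, hxU⟩)) = ⊤)
    (hgenT : Subgroup.normalClosure (({α₁, α₂, α₃, α₄} : Set (FundamentalGroup T ⟨x₀, hxT⟩)) ∪ S) = ⊤)
    (hS : S ⊆ Subgroup.normalClosure ({⁅α₃, α₄⁆} : Set (FundamentalGroup T ⟨x₀, hxT⟩)))
    (hY₁ : ⁅b₁⁻¹, d⁻¹⁆ = a₁) (hY₂ : ⁅a₁⁻¹, d⁆ = b₁) (hY₃ : ⁅d⁻¹, b₂⁻¹⁆ = c) (hY₄ : ⁅c⁻¹, b₂⁆ = d)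
    (hY₅ : ⁅b₁, c⁆ = 1)
    (hZ₁ : α₃ = ⁅α₁⁻¹, α₄⁻¹⁆) (hZ₂ : α₄ = ⁅α₁ ^ ε₁, α₃ ^ ε₃⁆ ^ m) (hZ₃ : ⁅α₂, α₄⁆ = 1)
    (hψ₁ : inclHom U x₀ hxU a₁ = inclHom T x₀ hxT α₁)
    (hψ₂ : inclHom U x₀ hxU b₁ = inclHom T x₀ hxT α₂)
    (hψ₃ : inclHom U x₀ hxU b₂ = inclHom T x₀ hxT α₄)
    (hψ₄ : ∃ t ∈ Subgroup.normalClosure ({⁅α₃, α₄⁆} : Set (FundamentalGroup T ⟨x₀, hxT⟩)),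
      inclHom U x₀ hxU a₂ = inclHom T x₀ hxT (α₃ ^ 2 * t)) :
    SimplyConnectedSpace X := by
  set ιU := inclHom U x₀ hxU with hιU
  set ιT := inclHom T x₀ hxT with hιT
  -- the normal closure of the meridian is mapped into the normal closure of its image
  have hmer : ∀ t ∈ Subgroup.normalClosure ({⁅α₃, α₄⁆} : Set (FundamentalGroup T ⟨x₀, hxT⟩)),
      ιT t ∈ Subgroup.normalClosure ({⁅ιT α₃, ιT α₄⁆} : Set (FundamentalGroup X x₀)) := by
    intro t ht
    have h := Subgroup.comap_normalClosure_image_ge ({⁅α₃, α₄⁆} : Set _) ιT ht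
    rwa [Subgroup.mem_comap, image_singleton, map_commutatorElement] at h
  -- all relations, pushed into `π₁(X, x₀)`
  have hrel := akhmedovPark2010_lemma8_pi1_generators_eq_one (G := FundamentalGroup X x₀)
    (a₁ := ιU a₁) (a₂ := ιU a₂) (b₁ := ιU b₁) (b₂ := ιU b₂) (c := ιU c) (d := ιU d)
    (α₁ := ιT α₁) (α₂ := ιT α₂) (α₃ := ιT α₃) (α₄ := ιT α₄) (m := m) (ε₁ := ε₁) (ε₃ := ε₃)
    (by rw [← map_inv, ← map_inv, ← map_commutatorElement, hY₁])
    (by rw [← map_inv, ← map_commutatorElement, hY₂])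
    (by rw [← map_inv, ← map_inv, ← map_commutatorElement, hY₃])
    (by rw [← map_inv, ← map_commutatorElement, hY₄])
    (by rw [← map_commutatorElement, hY₅, map_one])
    (by rw [← map_inv, ← map_inv, ← map_commutatorElement, ← hZ₁])
    (by rw [← map_zpow, ← map_zpow, ← map_commutatorElement, ← map_zpow, ← hZ₂])
    (by rw [← map_commutatorElement, hZ₃, map_one])
    hψ₁ hψ₂ hψ₃
    (by
      obtain ⟨t, ht, h⟩ := hψ₄
      exact ⟨ιT t, hmer t ht, by rw [h, map_mul, map_pow]⟩)
  obtain ⟨ha₁, ha₂, hb₁, hb₂, hc, hd, hα₁, hα₂, hα₃, hα₄⟩ := hrel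
  refine simplyConnectedSpace_of_cover_of_normalClosure_eq_top hUo hTo hcov hxU hxT hUpc hTpc
    hmeet hgenU hgenT ?_ ?_
  · intro a ha
    simp only [mem_insert_iff, mem_singleton_iff] at ha
    rcases ha with rfl | rfl | rfl | rfl | rfl | rfl
    exacts [ha₁, ha₂, hb₁, hb₂, hc, hd]
  · intro b hb
    rcases hb with hb | hb
    · simp only [mem_insert_iff, mem_singleton_iff] at hb
      rcases hb with rfl | rfl | rfl | rfl
      exacts [hα₁, hα₂, hα₃, hα₄]
    · -- elements of `S` lie in the normal closure of the meridian, which dies in `π₁(X, x₀)`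
      have h := hmer b (hS hb)
      have hN : Subgroup.normalClosure ({⁅ιT α₃, ιT α₄⁆} : Set (FundamentalGroup X x₀)) = ⊥ := by
        rw [Subgroup.normalClosure_eq_bot_iff, hα₃, hα₄, commutatorElement_one_right]
      rw [hN] at h
      exact Subgroup.mem_bot.1 h

/-! ### §4 Step (d) ⇒ Lemma 8 as vendored: a separating invariant gives the infinite exotic family -/

/-- **Akhmedov–Park 2010, Lemma 8, from steps (a)–(b) and a Seiberg–Witten–type separation
(step (d)).**  Let `X 0, X 1, …` be simply connected closed smooth 4-manifolds with
`rank H²(X m; ℤ)/T = 3` and `σ(X m, μ m) = -1` (steps (a)–(b): "`e(X₁(m)) = 5`,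
`σ(X₁(m)) = -1`", "`π₁(X₁(m)) = 1`"), and let `SW : ℕ → V` be ANY diffeomorphism invariant of the
family (`X i ≅ X j ⇒ SW i = SW j`) taking infinitely many values ("compute the Seiberg–Witten
invariants of `X₁(m)` and check that infinitely many of them are distinct").  **Then
`akhmedovPark2010_lemma8_invariants` holds**: choosing one index in each fibre of `SW` over an
`ℕ`-indexed family of distinct values gives the "infinite subset consisting of pairwise
non-diffeomorphic 4-manifolds", re-indexed by `ℕ`.  The input this theorem does not supply — a
diffeomorphism invariant separating infinitely many `X₁(m)` — is Seiberg–Witten theory with the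
product formulas of [MMS], absent from Mathlib and the tree.
[cite: AkhmedovPark2010, Lemma 8 and its proof (§9)] -/
theorem akhmedovPark2010_lemma8_invariants_of_infinite_range
    (X : ℕ → Type) [∀ m, TopologicalSpace (X m)] [∀ m, T2Space (X m)]
    [∀ m, SecondCountableTopology (X m)] [∀ m, ChartedSpace (EuclideanSpace ℝ (Fin 4)) (X m)]
    [∀ m, IsManifold (𝓡 4) ∞ (X m)] [∀ m, CompactSpace (X m)] [∀ m, SimplyConnectedSpace (X m)]
    (μ : ∀ m, HomologicalOrientation ℤ (X m) 4)
    (hinv : ∀ m, Module.finrank ℤ ↥(freeCohomology ℤ (X m) 2) = 3 ∧ (μ m).signature = -1)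
    {V : Type*} (SW : ℕ → V)
    (hSW : ∀ i j, Nonempty (X i ≃ₘ⟮𝓡 4, 𝓡 4⟯ X j) → SW i = SW j)
    (hinf : (range SW).Infinite) :
    akhmedovPark2010_lemma8_invariants := by
  -- an `ℕ`-indexed family of distinct values, and one index in each of their fibres
  set e : ℕ ↪ ↥(range SW) := hinf.natEmbedding
  have hφ : ∀ n, ∃ k, SW k = (e n : V) := fun n => (e n).2
  choose φ hφ using hφ
  refine ⟨fun n => X (φ n), fun n => inferInstance, fun n => inferInstance, fun n => inferInstance,
    fun n => inferInstance, fun n => inferInstance, fun n => inferInstance, fun n => inferInstance,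
    fun n => μ (φ n), fun n => hinv (φ n), fun i j hij => ?_⟩
  have h : (e i : V) = e j := by rw [← hφ i, ← hφ j]; exact hSW _ _ hij
  exact e.injective (Subtype.ext h)

/-- **The same, for a family indexed by any type** (the paper's `m ≥ 1`) and an invariant valued
anywhere: infinitely many values of a diffeomorphism invariant on simply connected closed smooth
4-manifolds with `b₂ = 3`, `σ = -1` give `akhmedovPark2010_lemma8_invariants`.
[cite: AkhmedovPark2010, Lemma 8 and its proof (§9)] -/
theorem akhmedovPark2010_lemma8_invariants_of_infinite_range'
    {ι : Type} (X : ι → Type) [∀ m, TopologicalSpace (X m)] [∀ m, T2Space (X m)]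
    [∀ m, SecondCountableTopology (X m)] [∀ m, ChartedSpace (EuclideanSpace ℝ (Fin 4)) (X m)]
    [∀ m, IsManifold (𝓡 4) ∞ (X m)] [∀ m, CompactSpace (X m)] [∀ m, SimplyConnectedSpace (X m)]
    (μ : ∀ m, HomologicalOrientation ℤ (X m) 4)
    (hinv : ∀ m, Module.finrank ℤ ↥(freeCohomology ℤ (X m) 2) = 3 ∧ (μ m).signature = -1)
    {V : Type*} (SW : ι → V)
    (hSW : ∀ i j, Nonempty (X i ≃ₘ⟮𝓡 4, 𝓡 4⟯ X j) → SW i = SW j)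
    (hinf : (range SW).Infinite) :
    akhmedovPark2010_lemma8_invariants := by
  set e : ℕ ↪ ↥(range SW) := hinf.natEmbedding
  have hφ : ∀ n, ∃ k, SW k = (e n : V) := fun n => (e n).2
  choose φ hφ using hφ
  refine akhmedovPark2010_lemma8_invariants_of_infinite_range (fun n => X (φ n))
    (fun n => μ (φ n)) (fun n => hinv (φ n)) (fun n => SW (φ n)) (fun i j hij => hSW _ _ hij) ?_
  have hinj : Function.Injective fun n => SW (φ n) := by
    intro i j h
    have h' : (e i : V) = e j := by rw [← hφ i, ← hφ j]; exact h
    exact e.injective (Subtype.ext h')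
  exact infinite_range_of_injective hinj

/-! ### §5 Step (a) as printed: `e(X₁(m)) = 5` is `b₂ = 3` for a simply connected closed 4-manifold -/

section Euler

open Literature.AlgebraicTopology.SingularHomology (singularHomology bettiNumber
  bettiNumber_int_eq_rat finrank_freeCohomology_eq_bettiNumber_holds finrank_eq_zero_of_isZero
  isZero_singularHomology_one_of_simplyConnectedSpace)
open Literature.Topology.FourManifolds (isOrientableOver_int_four_of_simplyConnectedSpace
  finrank_singularHomology_zero_eq_one_of_connected_four finrank_singularHomology_four_eq_one
  isZero_singularHomology_three_of_simplyConnectedSpace)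

variable {M : Type u} [TopologicalSpace M] [T2Space M] [ChartedSpace (EuclideanSpace ℝ (Fin 4)) M]
  [CompactSpace M] [SimplyConnectedSpace M]

/-- **`rank H₂(M; ℤ) = e(M) - 2` for a simply connected closed topological 4-manifold** `M`
(in any universe), with `e(M) = Σ_{j<5} (-1)ʲ rank H_j(M; ℤ)` the Euler characteristic as the
paper uses it ("`e(X₁(m)) = 5`", Akhmedov–Park 2010, proof of Lemma 8; "`b₂ = e - 2`" for
`π₁ = 1`, Kirby 1989, Ch. II §1).  Bookkeeping over the tree's theorems for such `M`:
`rank H₀ = 1` (path connected, Hatcher Prop. 2.7), `H₁ = 0` (Hurewicz, Thm. 2A.1,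
`isZero_singularHomology_one_of_simplyConnectedSpace`), `M` is `ℤ`-orientable (Prop. 3.25,
`isOrientableOver_int_four_of_simplyConnectedSpace`), hence `rank H₄ = 1` (Thm. 3.26 (a)) and
`H₃ ≅ H¹ = 0` (Poincaré duality Thm. 3.30, PROVED in the tree, with Thm. 3.2;
`isZero_singularHomology_three_of_simplyConnectedSpace`). [cite: AkhmedovPark2010, §9, proof of Lemma 8, step "e(X₁(m)) = 5"]
[cite: HatcherAT2002, Prop. 2.7, Thm. 2A.1, Prop. 3.25, Thm. 3.26, Thm. 3.30] [cite: Kirby1989, Ch. II §1] -/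
theorem finrank_singularHomology_two_eq_euler_sub_two :
    (Module.finrank ℤ (singularHomology ℤ ℤ M 2) : ℤ) =
      ∑ j ∈ Finset.range 5, (-1 : ℤ) ^ j * (Module.finrank ℤ (singularHomology ℤ ℤ M j) : ℤ) - 2 := by
  obtain ⟨μ⟩ := isOrientableOver_int_four_of_simplyConnectedSpace (X := M)
  have h0 : Module.finrank ℤ (singularHomology ℤ ℤ M 0) = 1 :=
    finrank_singularHomology_zero_eq_one_of_connected_four
  have h1 : Module.finrank ℤ (singularHomology ℤ ℤ M 1) = 0 :=
    finrank_eq_zero_of_isZero (isZero_singularHomology_one_of_simplyConnectedSpace ℤ ℤ (X := M))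
  have h3 : Module.finrank ℤ (singularHomology ℤ ℤ M 3) = 0 :=
    finrank_eq_zero_of_isZero (isZero_singularHomology_three_of_simplyConnectedSpace μ)
  have h4 : Module.finrank ℤ (singularHomology ℤ ℤ M 4) = 1 := finrank_singularHomology_four_eq_one μ
  simp only [Finset.sum_range_succ, Finset.sum_range_zero, h0, h1, h3, h4]
  push_cast
  ring

/-- **`rank (H²(M; ℤ)/T) = e(M) - 2` for a simply connected closed topological 4-manifold**: the
lattice `H²(M; ℤ)/torsion` carrying `Q_M` has rank `b₂(M; ℚ) = rank H₂(M; ℤ)` (universal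
coefficients, Hatcher §3.1 Cor. 3.3 and §3.A Cor. 3A.6 (a): the tree's PROVED
`finrank_freeCohomology_eq_bettiNumber_holds`, `bettiNumber_int_eq_rat`), and
`rank H₂ = e - 2` (`finrank_singularHomology_two_eq_euler_sub_two`).  This is the identity behind
the leaf's docstring: "`e = 5` is rendered as `rank H²(Xₘ; ℤ)/T = 3`, the same number `b₂ = e - 2`
for a simply connected closed 4-manifold (`b₁ = b₃ = 0`)". [cite: AkhmedovPark2010, §9, proof of Lemma 8]
[cite: HatcherAT2002, §3.1 Cor. 3.3 and §3.A Cor. 3A.6 (a)] [cite: Kirby1989, Ch. II §1] -/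
theorem finrank_freeCohomology_two_eq_euler_sub_two :
    (Module.finrank ℤ ↥(freeCohomology ℤ M 2) : ℤ) =
      ∑ j ∈ Finset.range 5, (-1 : ℤ) ^ j * (Module.finrank ℤ (singularHomology ℤ ℤ M j) : ℤ) - 2 := by
  have h : Module.finrank ℤ ↥(freeCohomology ℤ M 2) = bettiNumber ℚ M 2 :=
    finrank_freeCohomology_eq_bettiNumber_holds (n := 4) 2
  rw [h, ← bettiNumber_int_eq_rat]
  exact finrank_singularHomology_two_eq_euler_sub_two

/-- **Step (a) ⇒ the leaf's first invariant: `e(M) = 5` and `π₁(M) = 1` give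
`rank H²(M; ℤ)/T = 3`** for a closed topological 4-manifold ("`e(X₁(m)) = 5`" and
"`π₁(X₁(m)) = 1`" ⇒ "`b₂ = 3`", the form in which Freedman's theorem and the leaf consume it).
[cite: AkhmedovPark2010, §9, proof of Lemma 8] [cite: Kirby1989, Ch. II §1] -/
theorem finrank_freeCohomology_two_eq_three_of_euler_eq_five
    (hχ : ∑ j ∈ Finset.range 5, (-1 : ℤ) ^ j * (Module.finrank ℤ (singularHomology ℤ ℤ M j) : ℤ) = 5) :
    Module.finrank ℤ ↥(freeCohomology ℤ M 2) = 3 := by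
  have h := finrank_freeCohomology_two_eq_euler_sub_two (M := M)
  rw [hχ] at h
  norm_num at h
  exact_mod_cast h

/-- **Akhmedov–Park 2010, Lemma 8, from the printed inputs of steps (a), (b), (d) verbatim.**
Let `X 0, X 1, …` be closed smooth 4-manifolds with `π₁(X m) = 1` (step (b)),
`e(X m) = Σ_{j<5} (-1)ʲ rank H_j(X m; ℤ) = 5` and `σ(X m, μ m) = -1` (step (a): "`e(X₁(m)) =
e(Y₁(1,1)) + e(Z''(1,m)) - 2e(Σ₂) = 0 + 1 + 4 = 5`, `σ(X₁(m)) = σ(Y₁(1,1)) + σ(Z''(1,m)) =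
0 + (-1) = -1`"), and let `SW` be any diffeomorphism invariant of the family with infinitely many
values (step (d)).  Then `akhmedovPark2010_lemma8_invariants` holds: `b₂ = e - 2 = 3` by §5
(`finrank_freeCohomology_two_eq_three_of_euler_eq_five`) and §4
(`akhmedovPark2010_lemma8_invariants_of_infinite_range`).  Not supplied here, as in §4: the
construction of `X₁(m)` with these three numbers, and the separating Seiberg–Witten invariant.
[cite: AkhmedovPark2010, Lemma 8 and its proof (§9)] -/
theorem akhmedovPark2010_lemma8_invariants_of_euler_of_infinite_range
    (X : ℕ → Type) [∀ m, TopologicalSpace (X m)] [∀ m, T2Space (X m)]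
    [∀ m, SecondCountableTopology (X m)] [∀ m, ChartedSpace (EuclideanSpace ℝ (Fin 4)) (X m)]
    [∀ m, IsManifold (𝓡 4) ∞ (X m)] [∀ m, CompactSpace (X m)] [∀ m, SimplyConnectedSpace (X m)]
    (μ : ∀ m, HomologicalOrientation ℤ (X m) 4)
    (hχ : ∀ m, ∑ j ∈ Finset.range 5,
      (-1 : ℤ) ^ j * (Module.finrank ℤ (singularHomology ℤ ℤ (X m) j) : ℤ) = 5)
    (hσ : ∀ m, (μ m).signature = -1)
    {V : Type*} (SW : ℕ → V)
    (hSW : ∀ i j, Nonempty (X i ≃ₘ⟮𝓡 4, 𝓡 4⟯ X j) → SW i = SW j)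
    (hinf : (range SW).Infinite) :
    akhmedovPark2010_lemma8_invariants :=
  akhmedovPark2010_lemma8_invariants_of_infinite_range X μ
    (fun m => ⟨finrank_freeCohomology_two_eq_three_of_euler_eq_five (hχ m), hσ m⟩) SW hSW hinf

end Euler

/-! ### §6 Step (a), the computation: the Euler characteristic of a two-piece decomposition -/

section EulerCover

open Literature.AlgebraicTopology.SingularHomology (singularHomology relEuler FinRelHomology)
open Literature.AlgebraicTopology.Homotopy (IsNeighbourhoodRetract
  isNeighbourhoodRetract_range_of_compactSpace isNeighbourhoodRetract_of_locallyContractibleSpace_holds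
  locallyContractibleSpace_of_chartedSpace)
open Literature.Topology.FourManifolds (finCech_and_euler_of_homeomorph
  finRelHomology_of_compactSpace_four)

variable {X : Type u} [TopologicalSpace X] [T2Space X] [CompactSpace X]
  [ChartedSpace (EuclideanSpace ℝ (Fin 4)) X]

/-- **Inclusion–exclusion for the Euler characteristic of a closed topological 4-manifold cut
into two compact pieces** — the bookkeeping behind "`e(X₁(m)) = e(Y₁(1,1)) + e(Z''(1,m)) -
2e(Σ₂)`" (Akhmedov–Park 2010, proof of Lemma 8; Gompf–Stipsicz 1999, §1.2 and §10.2 use the same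
additivity for connected and fibre sums).  Let `X = K₁ ∪ K₂` with `K₁`, `K₂` compact, and let `K₁`,
`K₂`, `K₁ ∩ K₂` be homeomorphic to locally contractible spaces `P₁`, `P₂`, `P₀` (e.g. compact
manifolds with boundary: the two complements `Y ∖ ν°Σ`, `Z ∖ ν°Σ̄` and the gluing region
`∂νΣ ≅ Σ × S¹`) whose integral homology is finitely generated and zero from degree `5` on.  Then
`χ(X) = χ(P₁) + χ(P₂) - χ(P₀)` (`relEuler ℤ ℤ · ∅`, Mathlib's Euler characteristic of the graded
homology).  Proof: `X` embeds in some `ℝᵐ` as a neighbourhood retract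
(`exists_isClosedEmbedding_pi_of_compactSpace`, the tree's PROVED ENR theorem
`isNeighbourhoodRetract_of_locallyContractibleSpace_holds`); the rational Čech Euler
characteristics of the compact pieces are additive (Mayer–Vietoris, Spanier Ch. 4 §3 Thm. 14 and
Ch. 6 §1 Thm. 13: `Cech.euler_union`) and agree with the integral singular ones by tautness
(Spanier Thm. 6.1.10: `finCech_and_euler_of_homeomorph`), for `X` itself by the finiteness of the
homology of a closed manifold (`finRelHomology_of_compactSpace_four`).
[cite: AkhmedovPark2010, §9, proof of Lemma 8, "e(X₁(m)) = e(Y₁(1,1)) + e(Z''(1,m)) − 2e(Σ₂)"]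
[cite: Spanier1981, Ch. 4 §3 Thm. 14; Ch. 6 §1 Thm. 10, Thm. 13] -/
theorem relEuler_eq_of_compact_cover {K₁ K₂ : Set X} (hK₁ : IsCompact K₁) (hK₂ : IsCompact K₂)
    (hcov : K₁ ∪ K₂ = univ) {P₁ P₂ P₀ : Type u} [TopologicalSpace P₁] [TopologicalSpace P₂]
    [TopologicalSpace P₀] (φ₁ : ↥K₁ ≃ₜ P₁) (φ₂ : ↥K₂ ≃ₜ P₂) (φ₀ : ↥(K₁ ∩ K₂) ≃ₜ P₀)
    (hP₁ : LocallyContractibleSpace P₁) (hP₂ : LocallyContractibleSpace P₂)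
    (hP₀ : LocallyContractibleSpace P₀) (h₁ : FinRelHomology ℤ ℤ P₁ ∅ 5)
    (h₂ : FinRelHomology ℤ ℤ P₂ ∅ 5) (h₀ : FinRelHomology ℤ ℤ P₀ ∅ 5) :
    relEuler ℤ ℤ X ∅ = relEuler ℤ ℤ P₁ ∅ + relEuler ℤ ℤ P₂ ∅ - relEuler ℤ ℤ P₀ ∅ := by
  -- `X` embeds in some `ℝᵐ` as a neighbourhood retract (compact manifolds are ENRs)
  obtain ⟨m, ι, hιc⟩ :=
    Literature.Geometry.Manifold.exists_isClosedEmbedding_pi_of_compactSpace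
      (EuclideanSpace ℝ (Fin 4)) (M := X)
  have hι : Topology.IsEmbedding ι := hιc.isEmbedding
  have hX : IsNeighbourhoodRetract (range ι) :=
    isNeighbourhoodRetract_range_of_compactSpace isNeighbourhoodRetract_of_locallyContractibleSpace_holds
      (EuclideanSpace ℝ (Fin 4)) hι
  -- tautness on each compact piece, and on `X` itself
  obtain ⟨f₁, e₁⟩ := finCech_and_euler_of_homeomorph hι hX hK₁ φ₁ hP₁ h₁
  obtain ⟨f₂, e₂⟩ := finCech_and_euler_of_homeomorph hι hX hK₂ φ₂ hP₂ h₂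
  obtain ⟨f₀, e₀⟩ :=
    finCech_and_euler_of_homeomorph hι hX (hK₁.inter_right hK₂.isClosed) φ₀ hP₀ h₀
  obtain ⟨-, eX⟩ := finCech_and_euler_of_homeomorph hι hX isCompact_univ (Homeomorph.Set.univ X)
    (locallyContractibleSpace_of_chartedSpace (EuclideanSpace ℝ (Fin 4)) (M := X))
    (finRelHomology_of_compactSpace_four X)
  -- Mayer–Vietoris for the rational Čech Euler characteristic
  have hU := Literature.AlgebraicTopology.SingularHomology.Cech.euler_union
    (F := ℚ) (N := ModuleCat.of ℚ (ULift.{u} ℚ)) hK₁ hK₂ f₁ f₂ f₀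
  rw [hcov, eX, e₁, e₂, e₀] at hU
  exact hU

/-- The same with `χ(X)` written as the alternating sum of the ranks of `H₀(X; ℤ), …, H₄(X; ℤ)`
(the form of §5). [cite: AkhmedovPark2010, §9, proof of Lemma 8]
[cite: Spanier1981, Ch. 4 §3 Thm. 14; Ch. 6 §1 Thm. 10] -/
theorem sum_finrank_singularHomology_eq_of_compact_cover {K₁ K₂ : Set X} (hK₁ : IsCompact K₁)
    (hK₂ : IsCompact K₂) (hcov : K₁ ∪ K₂ = univ) {P₁ P₂ P₀ : Type u} [TopologicalSpace P₁]
    [TopologicalSpace P₂] [TopologicalSpace P₀] (φ₁ : ↥K₁ ≃ₜ P₁) (φ₂ : ↥K₂ ≃ₜ P₂)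
    (φ₀ : ↥(K₁ ∩ K₂) ≃ₜ P₀) (hP₁ : LocallyContractibleSpace P₁) (hP₂ : LocallyContractibleSpace P₂)
    (hP₀ : LocallyContractibleSpace P₀) (h₁ : FinRelHomology ℤ ℤ P₁ ∅ 5)
    (h₂ : FinRelHomology ℤ ℤ P₂ ∅ 5) (h₀ : FinRelHomology ℤ ℤ P₀ ∅ 5) :
    ∑ j ∈ Finset.range 5, (-1 : ℤ) ^ j * (Module.finrank ℤ (singularHomology ℤ ℤ X j) : ℤ) =
      relEuler ℤ ℤ P₁ ∅ + relEuler ℤ ℤ P₂ ∅ - relEuler ℤ ℤ P₀ ∅ := by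
  rw [← (finRelHomology_of_compactSpace_four X).relEuler_empty_eq_sum]
  exact relEuler_eq_of_compact_cover hK₁ hK₂ hcov φ₁ φ₂ φ₀ hP₁ hP₂ hP₀ h₁ h₂ h₀

/-- **Akhmedov–Park 2010, proof of Lemma 8, step (a) assembled: `e(X₁(m)) = 5`, hence
`b₂(X₁(m)) = 3`.**  "`e(X₁(m)) = e(Y₁(1,1)) + e(Z''(1,m)) - 2e(Σ₂) = 0 + 1 + 4 = 5`": cutting
the normal connected sum `X₁(m) = Y₁(1,1) #_ψ Z''(1,m)` along the gluing region into the two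
compact complements, `χ(Y₁(1,1) ∖ ν°Σ₂) = e(Y₁(1,1)) - e(Σ₂) = 0 + 2`,
`χ(Z''(1,m) ∖ ν°Σ̄₂) = e(Z''(1,m)) - e(Σ̄₂) = 1 + 2`, meeting in `∂νΣ₂ ≅ Σ₂ × S¹` with `χ = 0`.
Formally: a simply connected closed topological 4-manifold `X = K₁ ∪ K₂` as in
`relEuler_eq_of_compact_cover` with `χ(P₁) + χ(P₂) - χ(P₀) = 5` has `rank H²(X; ℤ)/T = 3`
(§5, `finrank_freeCohomology_two_eq_three_of_euler_eq_five`).  Feeding it the actual pieces of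
`X₁(m)` (and their three Euler characteristics) is what the missing construction must do.
[cite: AkhmedovPark2010, §9, proof of Lemma 8, step "e(X₁(m)) = 0 + 1 + 4 = 5"] -/
theorem akhmedovPark2010_lemma8_finrank_eq_three_of_cover [SimplyConnectedSpace X] {K₁ K₂ : Set X}
    (hK₁ : IsCompact K₁) (hK₂ : IsCompact K₂) (hcov : K₁ ∪ K₂ = univ) {P₁ P₂ P₀ : Type u}
    [TopologicalSpace P₁] [TopologicalSpace P₂] [TopologicalSpace P₀] (φ₁ : ↥K₁ ≃ₜ P₁)
    (φ₂ : ↥K₂ ≃ₜ P₂) (φ₀ : ↥(K₁ ∩ K₂) ≃ₜ P₀) (hP₁ : LocallyContractibleSpace P₁)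
    (hP₂ : LocallyContractibleSpace P₂) (hP₀ : LocallyContractibleSpace P₀)
    (h₁ : FinRelHomology ℤ ℤ P₁ ∅ 5) (h₂ : FinRelHomology ℤ ℤ P₂ ∅ 5)
    (h₀ : FinRelHomology ℤ ℤ P₀ ∅ 5)
    (he : relEuler ℤ ℤ P₁ ∅ + relEuler ℤ ℤ P₂ ∅ - relEuler ℤ ℤ P₀ ∅ = 5) :
    Module.finrank ℤ ↥(freeCohomology ℤ X 2) = 3 :=
  finrank_freeCohomology_two_eq_three_of_euler_eq_five
    ((sum_finrank_singularHomology_eq_of_compact_cover hK₁ hK₂ hcov φ₁ φ₂ φ₀ hP₁ hP₂ hP₀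
      h₁ h₂ h₀).trans he)

end EulerCover

/-! ### §7 Step (a), the two classical summands: the gluing region `Σ × S¹` and `χ(Y ∖ ν°Σ)` -/

section GluingRegion

open scoped unitInterval
open Literature.AlgebraicTopology.SingularHomology (relEuler FinRelHomology)
open Literature.AlgebraicTopology.Homotopy (locallyContractibleSpace_prod_addCircle
  locallyContractibleSpace_prod_unitInterval_sq)

variable {X : Type u} [TopologicalSpace X] [T2Space X] [CompactSpace X]
  [ChartedSpace (EuclideanSpace ℝ (Fin 4)) X]

/-- **`χ(Y ∖ ν°Σ) = χ(Y) - χ(Σ)`** — the printed summands "`e(Y₁(1,1)) - e(Σ₂) = 0 + 2`",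
"`e(Z''(1,m)) - e(Σ̄₂) = 1 + 2`" of step (a) (Akhmedov–Park 2010, proof of Lemma 8;
Gompf–Stipsicz 1999, §10.2 uses the same count for fibre sums).  Let the closed topological
4-manifold `Y = L₁ ∪ L₂` be cut into two compact pieces, `L₁` homeomorphic to a locally
contractible space `P` of finite homological type (the complement of the open tubular
neighbourhood of `Σ`), `L₂ ≅ F × (I × I)` (the closed tubular neighbourhood `Σ × D²`, `D² ≅ I²`)
and `L₁ ∩ L₂ ≅ F × S¹` (its boundary `Σ × S¹`, `S¹ = ℝ/ℤ`), for a strongly locally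
contractible `F` with `H_•(F; ℤ)` finitely generated, zero from degree `4` on (a closed surface:
`stronglyLocallyContractibleSpace_of_chartedSpace_normedSpace`).  Then `χ(P) = χ(Y) - χ(F)`: §6
(with `F × I²`, `F × S¹` locally contractible, `ManifoldStronglyLocallyContractible.lean`) gives
`χ(Y) = χ(P) + χ(F × I²) - χ(F × S¹)`, and
`χ(F × I²) = χ(F)`, `χ(F × S¹) = 0` by the tree's PROVED `FinRelHomology.unitInterval_prod`,
`FinRelHomology.prod_addCircle` (Hatcher 2002, Prop. 2.19, Thm. 2.20, Thm. 2.44).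
[cite: AkhmedovPark2010, §9, proof of Lemma 8, "e(X₁(m)) = e(Y₁(1,1)) + e(Z''(1,m)) − 2e(Σ₂)"]
[cite: HatcherAT2002, §2.2 Thm. 2.44] -/
theorem relEuler_eq_sub_of_tubular_cover {L₁ L₂ : Set X} (hL₁ : IsCompact L₁)
    (hL₂ : IsCompact L₂) (hcov : L₁ ∪ L₂ = univ) {P F : Type u} [TopologicalSpace P]
    [TopologicalSpace F] [StronglyLocallyContractibleSpace F] (φ₁ : ↥L₁ ≃ₜ P)
    (φ₂ : ↥L₂ ≃ₜ F × (I × I)) (φ₀ : ↥(L₁ ∩ L₂) ≃ₜ F × AddCircle (1 : ℝ))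
    (hP : LocallyContractibleSpace P) (hP' : FinRelHomology ℤ ℤ P ∅ 5)
    (hF : FinRelHomology ℤ ℤ F ∅ 4) :
    relEuler ℤ ℤ P ∅ = relEuler ℤ ℤ X ∅ - relEuler ℤ ℤ F ∅ := by
  have hFI := locallyContractibleSpace_prod_unitInterval_sq F
  have hFS := locallyContractibleSpace_prod_addCircle F (one_ne_zero : (1 : ℝ) ≠ 0)
  -- `χ(F × S¹) = 0`, `χ(F × I²) = χ(F)`, with finiteness
  obtain ⟨h₀, hχ₀⟩ := hF.prod_addCircle ℤ ℤ
  obtain ⟨hIF, hχIF⟩ := hF.unitInterval_prod ℤ ℤ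
  obtain ⟨hIIF, hχIIF⟩ := hIF.unitInterval_prod ℤ ℤ
  let e : (I × (I × F)) ≃ₜ F × (I × I) :=
    (Homeomorph.prodAssoc I I F).symm.trans (Homeomorph.prodComm (I × I) F)
  have h₂ : FinRelHomology ℤ ℤ (F × (I × I)) ∅ 5 :=
    (hIIF.of_homeomorph e (fun _ hx => False.elim hx) (fun _ hx => False.elim hx)).mono
      (by norm_num)
  have hχ₂ : relEuler ℤ ℤ (F × (I × I)) ∅ = relEuler ℤ ℤ F ∅ := by
    rw [← hχIF, ← hχIIF]
    exact (Literature.AlgebraicTopology.SingularHomology.relEuler_eq_of_homeomorph (R := ℤ)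
      (M := ℤ) (A := (∅ : Set (I × (I × F)))) e (fun _ hx => False.elim hx)
      (fun _ hx => False.elim hx)).symm
  have hY := relEuler_eq_of_compact_cover hL₁ hL₂ hcov φ₁ φ₂ φ₀ hP hFI hFS hP' h₂ h₀
  rw [hχ₂, hχ₀, sub_zero] at hY
  omega

/-- **Akhmedov–Park 2010, proof of Lemma 8, step (a), with the gluing region discharged.**
In `X₁(m) = (Y₁(1,1) ∖ ν°Σ₂) ∪ (Z''(1,m) ∖ ν°Σ̄₂)` the two compact pieces meet in
`∂νΣ₂ ≅ Σ₂ × S¹`, which has `χ = 0` and finitely generated homology as soon as `Σ₂` has (the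
tree's PROVED `FinRelHomology.prod_addCircle`: `χ(F × S¹) = χ(F)·χ(S¹) = 0`) and is locally
contractible with `F` (`locallyContractibleSpace_prod_addCircle`).  Hence, in the setting of §6
(`akhmedovPark2010_lemma8_finrank_eq_three_of_cover`) with `K₁ ∩ K₂ ≅ F × S¹` for a strongly
locally contractible `F` (a closed surface) with `H_•(F; ℤ)` finitely generated and zero from
degree `4` on, the hypothesis is just `χ(P₁) + χ(P₂) = 5` — the printed
"`(e(Y₁(1,1)) - e(Σ₂)) + (e(Z''(1,m)) - e(Σ̄₂)) = (0 + 2) + (1 + 2)`"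
(`relEuler_eq_sub_of_tubular_cover` for each summand) — and then `rank H²(X; ℤ)/T = 3`.
[cite: AkhmedovPark2010, §9, proof of Lemma 8, "e(X₁(m)) = 0 + 1 + 4 = 5"]
[cite: HatcherAT2002, §2.2 Thm. 2.44] -/
theorem akhmedovPark2010_lemma8_finrank_eq_three_of_cover_circle [SimplyConnectedSpace X]
    {K₁ K₂ : Set X} (hK₁ : IsCompact K₁) (hK₂ : IsCompact K₂) (hcov : K₁ ∪ K₂ = univ)
    {P₁ P₂ F : Type u} [TopologicalSpace P₁] [TopologicalSpace P₂] [TopologicalSpace F]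
    [StronglyLocallyContractibleSpace F] (φ₁ : ↥K₁ ≃ₜ P₁) (φ₂ : ↥K₂ ≃ₜ P₂)
    (φ₀ : ↥(K₁ ∩ K₂) ≃ₜ F × AddCircle (1 : ℝ)) (hP₁ : LocallyContractibleSpace P₁)
    (hP₂ : LocallyContractibleSpace P₂) (h₁ : FinRelHomology ℤ ℤ P₁ ∅ 5)
    (h₂ : FinRelHomology ℤ ℤ P₂ ∅ 5) (hF : FinRelHomology ℤ ℤ F ∅ 4)
    (he : relEuler ℤ ℤ P₁ ∅ + relEuler ℤ ℤ P₂ ∅ = 5) :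
    Module.finrank ℤ ↥(freeCohomology ℤ X 2) = 3 := by
  have hP₀ := locallyContractibleSpace_prod_addCircle F (one_ne_zero : (1 : ℝ) ≠ 0)
  obtain ⟨h₀, hχ₀⟩ := hF.prod_addCircle ℤ ℤ
  exact akhmedovPark2010_lemma8_finrank_eq_three_of_cover hK₁ hK₂ hcov φ₁ φ₂ φ₀ hP₁ hP₂ hP₀ h₁
    h₂ h₀ (by rw [hχ₀, sub_zero]; exact he)

end GluingRegion

/-! ### §8 Step (a), the printed numbers: `e` under torus surgery and connected sum; `e(T⁴)`, `e(ℂℙ²)` -/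

section PrintedNumbers

open scoped unitInterval
open CategoryTheory Limits
open Literature.AlgebraicTopology.SingularHomology (singularHomology relEuler FinRelHomology
  IsHomologySphere isHomologySphere_sphere finite_of_isZero finrank_eq_zero_of_isZero
  finRelHomology_empty_of_contractibleSpace relEuler_empty_of_contractibleSpace)
open Literature.AlgebraicTopology.Homotopy (locallyContractibleSpace_prod_addCircle
  stronglyLocallyContractibleSpace_addCircle locallyContractibleSpace_of_chartedSpace)
open Literature.Topology.FourManifolds (finrank_ulift_int)

/-- **`χ(S³) = 0`, with finiteness**: the integral homology of the round `S³ ⊆ ℝ⁴` is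
`ℤ, 0, 0, ℤ, 0, …` (Hatcher 2002, Cor. 2.14 and Prop. 2.7; the tree's PROVED
`isHomologySphere_sphere`), so it is finitely generated, vanishes from degree `4` on, and its Euler
characteristic is `1 - 1 = 0` (as `finRelHomology_sphere_four`, `TrisectionEulerProofs.lean`).
[cite: HatcherAT2002, Cor. 2.14] -/
theorem finRelHomology_sphere_three :
    FinRelHomology ℤ ℤ (Metric.sphere (0 : EuclideanSpace ℝ (Fin 4)) 1) ∅ 4 ∧
      relEuler ℤ ℤ (Metric.sphere (0 : EuclideanSpace ℝ (Fin 4)) 1) ∅ = 0 := by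
  have hS : IsHomologySphere (Metric.sphere (0 : EuclideanSpace ℝ (Fin 4)) 1) 3 :=
    isHomologySphere_sphere (n := 3) (by norm_num)
  haveI : PathConnectedSpace (Metric.sphere (0 : EuclideanSpace ℝ (Fin 4)) 1) := by
    refine isPathConnected_iff_pathConnectedSpace.mp (isPathConnected_sphere ?_ 0 zero_le_one)
    rw [← Module.finrank_eq_rank, finrank_euclideanSpace_fin]
    exact Nat.one_lt_cast.mpr (by norm_num)
  haveI := Literature.AlgebraicTopology.SingularHomology.singularHomology.isIso_ε_of_pathConnectedSpace
    ℤ ℤ (X := Metric.sphere (0 : EuclideanSpace ℝ (Fin 4)) 1)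
  let e0 : singularHomology ℤ ℤ (Metric.sphere (0 : EuclideanSpace ℝ (Fin 4)) 1) 0 ≅
      ModuleCat.of ℤ (ULift.{0} ℤ) :=
    asIso (Literature.AlgebraicTopology.SingularHomology.singularHomology.ε ℤ ℤ
      (Metric.sphere (0 : EuclideanSpace ℝ (Fin 4)) 1))
  let e3 : singularHomology ℤ ℤ (Metric.sphere (0 : EuclideanSpace ℝ (Fin 4)) 1) 3 ≅
      ModuleCat.of ℤ (ULift.{0} ℤ) :=
    hS.nonempty_iso.some
  have hZ : ∀ k, k ≠ 0 → k ≠ 3 →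
      IsZero (singularHomology ℤ ℤ (Metric.sphere (0 : EuclideanSpace ℝ (Fin 4)) 1) k) :=
    fun k hk0 hk3 => hS.1 k (Nat.pos_of_ne_zero hk0) hk3
  have hfin : ∀ k,
      Module.Finite ℤ (singularHomology ℤ ℤ (Metric.sphere (0 : EuclideanSpace ℝ (Fin 4)) 1) k) := by
    intro k
    by_cases hk0 : k = 0
    · subst hk0; exact Module.Finite.equiv e0.toLinearEquiv.symm
    by_cases hk3 : k = 3
    · subst hk3; exact Module.Finite.equiv e3.toLinearEquiv.symm
    exact finite_of_isZero (hZ k hk0 hk3)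
  have h : FinRelHomology ℤ ℤ (Metric.sphere (0 : EuclideanSpace ℝ (Fin 4)) 1) ∅ 4 :=
    FinRelHomology.empty_of_absolute hfin fun k hk => hZ k (by omega) (by omega)
  refine ⟨h, ?_⟩
  rw [h.relEuler_empty_eq_sum]
  simp only [Finset.sum_range_succ, Finset.sum_range_zero]
  rw [e0.toLinearEquiv.finrank_eq, e3.toLinearEquiv.finrank_eq, finrank_ulift_int,
    finrank_eq_zero_of_isZero (hZ 1 (by norm_num) (by norm_num)),
    finrank_eq_zero_of_isZero (hZ 2 (by norm_num) (by norm_num))]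
  norm_num

variable {X : Type u} [TopologicalSpace X] [T2Space X] [CompactSpace X]
  [ChartedSpace (EuclideanSpace ℝ (Fin 4)) X]

/-- **Puncturing costs one: `χ(A ∖ B°) = χ(A) - 1`.**  Let the closed topological 4-manifold
`A = L₁ ∪ L₂` be cut into two compact pieces, `L₁` homeomorphic to a locally contractible space
`P` of finite homological type (the punctured manifold), `L₂ ≅ D` contractible and strongly
locally contractible (the closed 4-ball) and `L₁ ∩ L₂ ≅ S³` (its boundary).  Then
`χ(P) = χ(A) - 1`: §6 gives `χ(A) = χ(P) + χ(D) - χ(S³) = χ(P) + 1 - 0`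
(`relEuler_empty_of_contractibleSpace`, `finRelHomology_sphere_three`; `S³` is locally
contractible as a manifold, Hatcher Cor. A.9). This is the count behind
"`e(A # B) = e(A) + e(B) - 2`" for the piece `T⁴ # ℂℙ²bar` of Akhmedov–Park's `Z''(1,m)`.
[cite: AkhmedovPark2010, §9, proof of Lemma 8, "e(Z''(1,m)) = 1"] [cite: HatcherAT2002, §2.2 Thm. 2.44 and Cor. A.9] -/
theorem relEuler_eq_sub_one_of_punctured_cover {L₁ L₂ : Set X} (hL₁ : IsCompact L₁)
    (hL₂ : IsCompact L₂) (hcov : L₁ ∪ L₂ = univ) {P D : Type u} [TopologicalSpace P]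
    [TopologicalSpace D] [ContractibleSpace D] [StronglyLocallyContractibleSpace D]
    (φ₁ : ↥L₁ ≃ₜ P) (φ₂ : ↥L₂ ≃ₜ D)
    (φ₀ : ↥(L₁ ∩ L₂) ≃ₜ ULift.{u} (Metric.sphere (0 : EuclideanSpace ℝ (Fin 4)) 1))
    (hP : LocallyContractibleSpace P) (hP' : FinRelHomology ℤ ℤ P ∅ 5) :
    relEuler ℤ ℤ P ∅ = relEuler ℤ ℤ X ∅ - 1 := by
  -- the sphere, moved into the universe of `X`
  obtain ⟨hS, hSe⟩ := finRelHomology_sphere_three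
  let ψ : ULift.{u} (Metric.sphere (0 : EuclideanSpace ℝ (Fin 4)) 1) ≃ₜ
      (Metric.sphere (0 : EuclideanSpace ℝ (Fin 4)) 1) := Homeomorph.ulift
  have h₀ : FinRelHomology ℤ ℤ (ULift.{u} (Metric.sphere (0 : EuclideanSpace ℝ (Fin 4)) 1)) ∅ 5 :=
    (hS.of_homeomorph ψ.symm (mapsTo_empty _ _) (mapsTo_empty _ _)).mono (by norm_num)
  have hχ₀ : relEuler ℤ ℤ (ULift.{u} (Metric.sphere (0 : EuclideanSpace ℝ (Fin 4)) 1)) ∅ = 0 := by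
    rw [← hSe]
    exact (Literature.AlgebraicTopology.SingularHomology.relEuler_eq_of_homeomorph (R := ℤ)
      (M := ℤ) (A := (∅ : Set (ULift.{u} (Metric.sphere (0 : EuclideanSpace ℝ (Fin 4)) 1)))) ψ
      (mapsTo_empty _ _) (mapsTo_empty _ _))
  have hP₀ : LocallyContractibleSpace (ULift.{u} (Metric.sphere (0 : EuclideanSpace ℝ (Fin 4)) 1)) :=
    Literature.AlgebraicTopology.Homotopy.locallyContractibleSpace_of_homeomorph ψ.symm
      (locallyContractibleSpace_of_chartedSpace (EuclideanSpace ℝ (Fin 3))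
        (M := Metric.sphere (0 : EuclideanSpace ℝ (Fin 4)) 1))
  -- the ball
  have hD : LocallyContractibleSpace D := StronglyLocallyContractibleSpace.locallyContractible
  have h₂ : FinRelHomology ℤ ℤ D ∅ 5 :=
    (finRelHomology_empty_of_contractibleSpace ℤ ℤ (X := D)).mono (by norm_num)
  have hχ₂ : relEuler ℤ ℤ D ∅ = 1 := by
    rw [relEuler_empty_of_contractibleSpace ℤ ℤ (X := D), Module.finrank_self]
    rfl
  have hA := relEuler_eq_of_compact_cover hL₁ hL₂ hcov φ₁ φ₂ φ₀ hP hD hP₀ hP' h₂ h₀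
  rw [hχ₂, hχ₀, sub_zero] at hA
  omega

/-- **`e(A # B) = e(A) + e(B) - 2`** for a connected sum of closed topological 4-manifolds,
presented by its pieces: `X = K₁ ∪ K₂` with `K₁ ≅ P_A`, `K₂ ≅ P_B` the two punctured manifolds
meeting in `K₁ ∩ K₂ ≅ S³`, and `A`, `B` cut into `P_A ∪ D⁴`, `P_B ∪ D⁴` along `S³` as in
`relEuler_eq_sub_one_of_punctured_cover`.  Then `χ(X) = χ(P_A) + χ(P_B) - χ(S³) =
(χ(A) - 1) + (χ(B) - 1) - 0` (Gompf–Stipsicz 1999, §1.2; the count behind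
"`e(T⁴ # ℂℙ²bar) = 0 + 3 - 2 = 1`" for Akhmedov–Park's `Z''(1,m)`).
[cite: AkhmedovPark2010, §9, proof of Lemma 8, "e(Z''(1,m)) = 1"] [cite: HatcherAT2002, §2.2 Thm. 2.44] -/
theorem relEuler_eq_of_connectedSum_covers {A B : Type u} [TopologicalSpace A] [T2Space A]
    [CompactSpace A] [ChartedSpace (EuclideanSpace ℝ (Fin 4)) A] [TopologicalSpace B] [T2Space B]
    [CompactSpace B] [ChartedSpace (EuclideanSpace ℝ (Fin 4)) B]
    {K₁ K₂ : Set X} (hK₁ : IsCompact K₁) (hK₂ : IsCompact K₂) (hcov : K₁ ∪ K₂ = univ)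
    {LA₁ LA₂ : Set A} (hLA₁ : IsCompact LA₁) (hLA₂ : IsCompact LA₂) (hcovA : LA₁ ∪ LA₂ = univ)
    {LB₁ LB₂ : Set B} (hLB₁ : IsCompact LB₁) (hLB₂ : IsCompact LB₂) (hcovB : LB₁ ∪ LB₂ = univ)
    {PA PB DA DB : Type u} [TopologicalSpace PA] [TopologicalSpace PB] [TopologicalSpace DA]
    [TopologicalSpace DB] [ContractibleSpace DA] [StronglyLocallyContractibleSpace DA]
    [ContractibleSpace DB] [StronglyLocallyContractibleSpace DB]
    (φ₁ : ↥K₁ ≃ₜ PA) (φ₂ : ↥K₂ ≃ₜ PB)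
    (φ₀ : ↥(K₁ ∩ K₂) ≃ₜ ULift.{u} (Metric.sphere (0 : EuclideanSpace ℝ (Fin 4)) 1))
    (α₁ : ↥LA₁ ≃ₜ PA) (α₂ : ↥LA₂ ≃ₜ DA)
    (α₀ : ↥(LA₁ ∩ LA₂) ≃ₜ ULift.{u} (Metric.sphere (0 : EuclideanSpace ℝ (Fin 4)) 1))
    (β₁ : ↥LB₁ ≃ₜ PB) (β₂ : ↥LB₂ ≃ₜ DB)
    (β₀ : ↥(LB₁ ∩ LB₂) ≃ₜ ULift.{u} (Metric.sphere (0 : EuclideanSpace ℝ (Fin 4)) 1))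
    (hPA : LocallyContractibleSpace PA) (hPB : LocallyContractibleSpace PB)
    (hPA' : FinRelHomology ℤ ℤ PA ∅ 5) (hPB' : FinRelHomology ℤ ℤ PB ∅ 5) :
    relEuler ℤ ℤ X ∅ = relEuler ℤ ℤ A ∅ + relEuler ℤ ℤ B ∅ - 2 := by
  have hA := relEuler_eq_sub_one_of_punctured_cover hLA₁ hLA₂ hcovA α₁ α₂ α₀ hPA hPA'
  have hB := relEuler_eq_sub_one_of_punctured_cover hLB₁ hLB₂ hcovB β₁ β₂ β₀ hPB hPB'
  -- the gluing sphere, in the universe of `X`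
  obtain ⟨hS, hSe⟩ := finRelHomology_sphere_three
  let ψ : ULift.{u} (Metric.sphere (0 : EuclideanSpace ℝ (Fin 4)) 1) ≃ₜ
      (Metric.sphere (0 : EuclideanSpace ℝ (Fin 4)) 1) := Homeomorph.ulift
  have h₀ : FinRelHomology ℤ ℤ (ULift.{u} (Metric.sphere (0 : EuclideanSpace ℝ (Fin 4)) 1)) ∅ 5 :=
    (hS.of_homeomorph ψ.symm (mapsTo_empty _ _) (mapsTo_empty _ _)).mono (by norm_num)
  have hχ₀ : relEuler ℤ ℤ (ULift.{u} (Metric.sphere (0 : EuclideanSpace ℝ (Fin 4)) 1)) ∅ = 0 := by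
    rw [← hSe]
    exact (Literature.AlgebraicTopology.SingularHomology.relEuler_eq_of_homeomorph (R := ℤ)
      (M := ℤ) (A := (∅ : Set (ULift.{u} (Metric.sphere (0 : EuclideanSpace ℝ (Fin 4)) 1)))) ψ
      (mapsTo_empty _ _) (mapsTo_empty _ _))
  have hP₀ : LocallyContractibleSpace (ULift.{u} (Metric.sphere (0 : EuclideanSpace ℝ (Fin 4)) 1)) :=
    Literature.AlgebraicTopology.Homotopy.locallyContractibleSpace_of_homeomorph ψ.symm
      (locallyContractibleSpace_of_chartedSpace (EuclideanSpace ℝ (Fin 3))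
        (M := Metric.sphere (0 : EuclideanSpace ℝ (Fin 4)) 1))
  have hX := relEuler_eq_of_compact_cover hK₁ hK₂ hcov φ₁ φ₂ φ₀ hPA hPB hP₀ hPA' hPB' h₀
  rw [hχ₀, sub_zero, hA, hB] at hX
  omega

/-- **Torus surgery (in particular Luttinger surgery) preserves `e`.**  Let the closed topological
4-manifolds `Y = L₁ ∪ L₂` and `Y' = L₁' ∪ L₂'` be cut into compact pieces with the SAME
complement `L₁ ≅ P ≅ L₁'` (the exterior of the torus, locally contractible of finite type),
`L₂, L₂' ≅ T² × (I × I)` (the tubes `T² × D²`, glued back differently) and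
`L₁ ∩ L₂, L₁' ∩ L₂' ≅ T² × S¹ = T³`.  Then `χ(Y) = χ(Y')`: both equal `χ(P)` by §7
(`relEuler_eq_sub_of_tubular_cover` with `F = T²`, `χ(T²) = 0`, the tree's PROVED
`FinRelHomology.addCircle_prod` over a point).  This is why the surgered manifolds
`Y₁(1,1)` (from `Σ₂ × T²`) and `Z''(1,m)` (from `T⁴ # ℂℙ²bar`) of Akhmedov–Park 2010 keep
`e = 0`, `e = 1`. [cite: AkhmedovPark2010, §9, proof of Lemma 8, "e(X₁(m)) = … = 0 + 1 + 4"]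
[cite: HatcherAT2002, §2.2 Thm. 2.44] -/
theorem relEuler_eq_of_torusSurgery_covers {Y' : Type u} [TopologicalSpace Y'] [T2Space Y']
    [CompactSpace Y'] [ChartedSpace (EuclideanSpace ℝ (Fin 4)) Y']
    {L₁ L₂ : Set X} (hL₁ : IsCompact L₁) (hL₂ : IsCompact L₂) (hcov : L₁ ∪ L₂ = univ)
    {L₁' L₂' : Set Y'} (hL₁' : IsCompact L₁') (hL₂' : IsCompact L₂') (hcov' : L₁' ∪ L₂' = univ)
    {P : Type u} [TopologicalSpace P] (φ₁ : ↥L₁ ≃ₜ P)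
    (φ₂ : ↥L₂ ≃ₜ ULift.{u} (AddCircle (1 : ℝ) × AddCircle (1 : ℝ)) × (I × I))
    (φ₀ : ↥(L₁ ∩ L₂) ≃ₜ ULift.{u} (AddCircle (1 : ℝ) × AddCircle (1 : ℝ)) × AddCircle (1 : ℝ))
    (φ₁' : ↥L₁' ≃ₜ P) (φ₂' : ↥L₂' ≃ₜ ULift.{u} (AddCircle (1 : ℝ) × AddCircle (1 : ℝ)) × (I × I))
    (φ₀' : ↥(L₁' ∩ L₂') ≃ₜ ULift.{u} (AddCircle (1 : ℝ) × AddCircle (1 : ℝ)) × AddCircle (1 : ℝ))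
    (hP : LocallyContractibleSpace P) (hP' : FinRelHomology ℤ ℤ P ∅ 5) :
    relEuler ℤ ℤ X ∅ = relEuler ℤ ℤ Y' ∅ := by
  -- the torus `T²`, in the universe of `X`: strongly locally contractible, `χ = 0`
  haveI := stronglyLocallyContractibleSpace_addCircle (one_ne_zero : (1 : ℝ) ≠ 0)
  let ψ : ULift.{u} (AddCircle (1 : ℝ) × AddCircle (1 : ℝ)) ≃ₜ
      (AddCircle (1 : ℝ) × AddCircle (1 : ℝ)) := Homeomorph.ulift
  haveI : StronglyLocallyContractibleSpace (ULift.{u} (AddCircle (1 : ℝ) × AddCircle (1 : ℝ))) :=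
    ψ.isOpenEmbedding.stronglyLocallyContractibleSpace
  -- `χ(T²) = 0` with finiteness, from a point (`FinRelHomology.addCircle_prod` twice)
  have hpt : FinRelHomology ℤ ℤ PUnit.{u + 1} ∅ 1 := finRelHomology_empty_of_contractibleSpace ℤ ℤ
  obtain ⟨hS1, -⟩ :=
    Literature.AlgebraicTopology.SingularHomology.FinRelHomology.addCircle_prod ℤ ℤ hpt
  obtain ⟨hT, hTe⟩ :=
    Literature.AlgebraicTopology.SingularHomology.FinRelHomology.addCircle_prod ℤ ℤ hS1
  let ψ₀ : AddCircle (1 : ℝ) × (AddCircle (1 : ℝ) × PUnit.{u + 1}) ≃ₜ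
      ULift.{u} (AddCircle (1 : ℝ) × AddCircle (1 : ℝ)) :=
    ((Homeomorph.refl _).prodCongr (Homeomorph.prodPUnit _)).trans ψ.symm
  have hF : FinRelHomology ℤ ℤ (ULift.{u} (AddCircle (1 : ℝ) × AddCircle (1 : ℝ))) ∅ 4 :=
    (hT.of_homeomorph ψ₀ (mapsTo_empty _ _) (mapsTo_empty _ _)).mono (by norm_num)
  have hFe : relEuler ℤ ℤ (ULift.{u} (AddCircle (1 : ℝ) × AddCircle (1 : ℝ))) ∅ = 0 := by
    rw [← hTe]
    exact (Literature.AlgebraicTopology.SingularHomology.relEuler_eq_of_homeomorph (R := ℤ)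
      (M := ℤ) (A := (∅ : Set (AddCircle (1 : ℝ) × (AddCircle (1 : ℝ) × PUnit.{u + 1})))) ψ₀
      (mapsTo_empty _ _) (mapsTo_empty _ _)).symm
  have hY := relEuler_eq_sub_of_tubular_cover hL₁ hL₂ hcov φ₁ φ₂ φ₀ hP hP' hF
  have hY' := relEuler_eq_sub_of_tubular_cover hL₁' hL₂' hcov' φ₁' φ₂' φ₀' hP hP' hF
  rw [hFe, sub_zero] at hY hY'
  rw [← hY, ← hY']

/-- **`e(T⁴) = 0`** (and finiteness) for the 4-torus `(ℝ/ℤ)⁴` — the summand `T⁴` of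
Akhmedov–Park's `T⁴ # ℂℙ²bar` (`FinRelHomology.addCircle_prod` four times over a point).
[cite: AkhmedovPark2010, §9, proof of Lemma 8, "e(Z''(1,m)) = 1"] [cite: HatcherAT2002, §2.2 Thm. 2.44] -/
theorem relEuler_torus_four :
    FinRelHomology ℤ ℤ ((AddCircle (1 : ℝ) × AddCircle (1 : ℝ)) ×
        (AddCircle (1 : ℝ) × AddCircle (1 : ℝ))) ∅ 5 ∧
      relEuler ℤ ℤ ((AddCircle (1 : ℝ) × AddCircle (1 : ℝ)) ×
        (AddCircle (1 : ℝ) × AddCircle (1 : ℝ))) ∅ = 0 := by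
  -- from a point, `FinRelHomology.addCircle_prod` four times, then reassociate
  have hpt : FinRelHomology ℤ ℤ PUnit.{1} ∅ 1 := finRelHomology_empty_of_contractibleSpace ℤ ℤ
  obtain ⟨h1, -⟩ :=
    Literature.AlgebraicTopology.SingularHomology.FinRelHomology.addCircle_prod ℤ ℤ hpt
  obtain ⟨h2, -⟩ :=
    Literature.AlgebraicTopology.SingularHomology.FinRelHomology.addCircle_prod ℤ ℤ h1
  obtain ⟨h3, -⟩ :=
    Literature.AlgebraicTopology.SingularHomology.FinRelHomology.addCircle_prod ℤ ℤ h2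
  obtain ⟨h4, h4e⟩ :=
    Literature.AlgebraicTopology.SingularHomology.FinRelHomology.addCircle_prod ℤ ℤ h3
  let e : AddCircle (1 : ℝ) × (AddCircle (1 : ℝ) × (AddCircle (1 : ℝ) × (AddCircle (1 : ℝ) ×
      PUnit.{1}))) ≃ₜ
      (AddCircle (1 : ℝ) × AddCircle (1 : ℝ)) × (AddCircle (1 : ℝ) × AddCircle (1 : ℝ)) :=
    ((Homeomorph.refl _).prodCongr ((Homeomorph.refl _).prodCongr
      ((Homeomorph.refl _).prodCongr (Homeomorph.prodPUnit _)))).trans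
      (Homeomorph.prodAssoc _ _ _).symm
  refine ⟨h4.of_homeomorph e (mapsTo_empty _ _) (mapsTo_empty _ _), ?_⟩
  rw [← h4e]
  exact (Literature.AlgebraicTopology.SingularHomology.relEuler_eq_of_homeomorph (R := ℤ)
    (M := ℤ) (A := (∅ : Set (AddCircle (1 : ℝ) × (AddCircle (1 : ℝ) × (AddCircle (1 : ℝ) ×
      (AddCircle (1 : ℝ) × PUnit.{1}))))))
    e (mapsTo_empty _ _) (mapsTo_empty _ _)).symm

/-- **`e(ℂℙ²) = 3`**: `Σ_{j<5} (-1)ʲ rank H_j(ℂℙ²; ℤ) = 3` for the tree's complex projective plane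
(a simply connected closed 4-manifold with `H²(ℂℙ²; ℤ)/T ≅ ℤ`, PROVED:
`ComplexProjectivePlane.freeCohomologyTwoLinearEquivInt`), by §5 (`rank H²/T = e - 2`).  With the
orientation reversed, `e(ℂℙ²bar) = 3` is the same number (same space) — the summand of
Akhmedov–Park's `e(T⁴ # ℂℙ²bar) = 0 + 3 - 2 = 1`.
[cite: AkhmedovPark2010, §9, proof of Lemma 8, "e(Z''(1,m)) = 1"] [cite: HatcherAT2002, §2.2 Thm. 2.44] -/
theorem euler_complexProjectivePlane :
    ∑ j ∈ Finset.range 5, (-1 : ℤ) ^ j *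
      (Module.finrank ℤ (singularHomology ℤ ℤ
        Literature.Topology.FourManifolds.ComplexProjectivePlane j) : ℤ) = 3 := by
  have h := finrank_freeCohomology_two_eq_euler_sub_two
    (M := Literature.Topology.FourManifolds.ComplexProjectivePlane)
  rw [Literature.Topology.FourManifolds.ComplexProjectivePlane.freeCohomologyTwoLinearEquivInt
      |>.finrank_eq, Module.finrank_self] at h
  omega

end PrintedNumbers

/-! ### §9 Step (a), the last printed number: `e(Σ₂) = -2` for a closed oriented surface with `rank H₁ = 4` -/

section Surface

open CategoryTheory Limits
open Literature.AlgebraicTopology.SingularHomology (singularHomology relEuler FinRelHomology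
  finite_singularHomology_of_compactSpace_holds isZero_singularHomology_of_lt_holds
  nonempty_singularHomology_top_iso_holds finrank_singularHomology_zero_of_pathConnectedSpace)
open Literature.AlgebraicTopology.Homotopy (stronglyLocallyContractibleSpace_of_chartedSpace_normedSpace)
open Literature.Topology.FourManifolds (finrank_ulift_int)

/-- **`e(F) = 2 - b₁(F)` for a closed connected `ℤ`-oriented topological surface**, with
finiteness: `H_•(F; ℤ)` is finitely generated and zero from degree `3` on (Hatcher 2002, App. A
Cor. A.8–A.9, Thm. 3.26; the tree's PROVED `finite_singularHomology_of_compactSpace_holds`,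
`isZero_singularHomology_of_lt_holds`, `nonempty_singularHomology_top_iso_holds`), and
`χ(F) = rank H₀ - rank H₁ + rank H₂ = 1 - rank H₁(F; ℤ) + 1`.  For the genus-`g` surface,
`rank H₁ = 2g` and `e(Σ_g) = 2 - 2g`: the printed `e(Σ₂) = -2` behind
"`-2e(Σ₂) = +4`" (Akhmedov–Park 2010, proof of Lemma 8). [cite: AkhmedovPark2010, §9, proof of Lemma 8, "− 2e(Σ₂) = 4"]
[cite: HatcherAT2002, Thm. 3.26 (a) and App. A Cor. A.8–A.9] -/
theorem finRelHomology_and_relEuler_surface (F : Type u) [TopologicalSpace F] [T2Space F]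
    [CompactSpace F] [ChartedSpace (EuclideanSpace ℝ (Fin 2)) F] [ConnectedSpace F]
    (μ : HomologicalOrientation ℤ F 2) :
    FinRelHomology ℤ ℤ F ∅ 3 ∧
      relEuler ℤ ℤ F ∅ = 2 - (Module.finrank ℤ (singularHomology ℤ ℤ F 1) : ℤ) := by
  have h : FinRelHomology ℤ ℤ F ∅ 3 :=
    FinRelHomology.empty_of_absolute (fun j => finite_singularHomology_of_compactSpace_holds ℤ F 2 j)
      (fun _ hj => isZero_singularHomology_of_lt_holds ℤ ℤ F 2 (by omega))
  refine ⟨h, ?_⟩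
  -- `rank H₀ = 1`: a connected manifold is path connected
  haveI := ChartedSpace.locallyPathConnectedSpace (EuclideanSpace ℝ (Fin 2)) F
  haveI : PathConnectedSpace F := pathConnectedSpace_iff_connectedSpace.mpr inferInstance
  have h0 : Module.finrank ℤ (singularHomology ℤ ℤ F 0) = 1 := by
    rw [finrank_singularHomology_zero_of_pathConnectedSpace ℤ ℤ, Module.finrank_self]
  -- `rank H₂ = 1`: the fundamental class
  have h2 : Module.finrank ℤ (singularHomology ℤ ℤ F 2) = 1 := by
    obtain ⟨e⟩ := nonempty_singularHomology_top_iso_holds (R := ℤ) (X := F) 2 μ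
    rw [e.toLinearEquiv.finrank_eq, finrank_ulift_int]
  rw [h.relEuler_empty_eq_sum]
  simp only [Finset.sum_range_succ, Finset.sum_range_zero, h0, h2]
  push_cast
  ring

/-- **`e(Σ₂) = -2`**, in the form consumed by §7: a closed connected `ℤ`-oriented surface `F`
with `rank H₁(F; ℤ) = 4` (the genus-2 surface) has `H_•(F; ℤ)` finitely generated, zero from
degree `4` on, and `χ(F) = -2`. [cite: AkhmedovPark2010, §9, proof of Lemma 8, "− 2e(Σ₂) = 4"]
[cite: HatcherAT2002, Thm. 3.26 (a)] -/
theorem relEuler_surface_of_finrank_one_eq_four (F : Type u) [TopologicalSpace F] [T2Space F]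
    [CompactSpace F] [ChartedSpace (EuclideanSpace ℝ (Fin 2)) F] [ConnectedSpace F]
    (μ : HomologicalOrientation ℤ F 2) (h1 : Module.finrank ℤ (singularHomology ℤ ℤ F 1) = 4) :
    FinRelHomology ℤ ℤ F ∅ 4 ∧ relEuler ℤ ℤ F ∅ = -2 := by
  obtain ⟨h, he⟩ := finRelHomology_and_relEuler_surface F μ
  refine ⟨h.mono (by norm_num), ?_⟩
  rw [he, h1]
  norm_num

variable {X : Type u} [TopologicalSpace X] [T2Space X] [CompactSpace X]
  [ChartedSpace (EuclideanSpace ℝ (Fin 4)) X]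

/-- **Akhmedov–Park 2010, proof of Lemma 8, step (a): `e(X₁(m)) = 5 ⇒ b₂ = 3`, with every
classical input discharged.**  Let the simply connected closed topological 4-manifold
`X = K₁ ∪ K₂` be cut into two compact pieces homeomorphic to locally contractible spaces `P₁`,
`P₂` of finite homological type (the complements `Y₁(1,1) ∖ ν°Σ₂`, `Z''(1,m) ∖ ν°Σ̄₂`), meeting
in `K₁ ∩ K₂ ≅ F × S¹` for a closed connected `ℤ`-oriented topological surface `F` with
`rank H₁(F; ℤ) = 4` (the genus-2 surface `Σ₂`; `S¹ = ℝ/ℤ`), and let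
`χ(P₁) + χ(P₂) = 5` — the printed `(e(Y₁(1,1)) - e(Σ₂)) + (e(Z''(1,m)) - e(Σ̄₂)) =
(0 + 2) + (1 + 2)` (§7 `relEuler_eq_sub_of_tubular_cover`, §8, §9).  Then
`rank H²(X; ℤ)/T = 3`.  Everything about `F × S¹` (local contractibility as a manifold times a
circle, finiteness, `χ = 0`) and about `F` (`χ(Σ₂) = -2`, finiteness) is now a theorem of the
tree; what remains for the construction is to exhibit `X₁(m)` with this decomposition.
[cite: AkhmedovPark2010, §9, proof of Lemma 8, "e(X₁(m)) = e(Y₁(1,1)) + e(Z''(1,m)) − 2e(Σ₂) = 0 + 1 + 4 = 5"]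
[cite: HatcherAT2002, §2.2 Thm. 2.44] -/
theorem akhmedovPark2010_lemma8_finrank_eq_three_of_cover_surface [SimplyConnectedSpace X]
    {K₁ K₂ : Set X} (hK₁ : IsCompact K₁) (hK₂ : IsCompact K₂) (hcov : K₁ ∪ K₂ = univ)
    {P₁ P₂ F : Type u} [TopologicalSpace P₁] [TopologicalSpace P₂] [TopologicalSpace F]
    [T2Space F] [CompactSpace F] [ChartedSpace (EuclideanSpace ℝ (Fin 2)) F] [ConnectedSpace F]
    (μF : HomologicalOrientation ℤ F 2) (hF1 : Module.finrank ℤ (singularHomology ℤ ℤ F 1) = 4)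
    (φ₁ : ↥K₁ ≃ₜ P₁) (φ₂ : ↥K₂ ≃ₜ P₂) (φ₀ : ↥(K₁ ∩ K₂) ≃ₜ F × AddCircle (1 : ℝ))
    (hP₁ : LocallyContractibleSpace P₁) (hP₂ : LocallyContractibleSpace P₂)
    (h₁ : FinRelHomology ℤ ℤ P₁ ∅ 5) (h₂ : FinRelHomology ℤ ℤ P₂ ∅ 5)
    (he : relEuler ℤ ℤ P₁ ∅ + relEuler ℤ ℤ P₂ ∅ = 5) :
    Module.finrank ℤ ↥(freeCohomology ℤ X 2) = 3 := by
  haveI := stronglyLocallyContractibleSpace_of_chartedSpace_normedSpace (EuclideanSpace ℝ (Fin 2)) F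
  obtain ⟨hF, -⟩ := relEuler_surface_of_finrank_one_eq_four F μF hF1
  exact akhmedovPark2010_lemma8_finrank_eq_three_of_cover_circle hK₁ hK₂ hcov φ₁ φ₂ φ₀ hP₁ hP₂ h₁
    h₂ hF he

end Surface

/-! ### §10 Step (a), the Euler side in tube coordinates: `χ(Y ∖ ν°Σ) = χ(Y) - χ(Σ)`, `b₂ = 3` -/

section Tube

open CategoryTheory Limits
open Literature.AlgebraicTopology.SingularHomology (singularHomology relEuler FinRelHomology)
open Literature.AlgebraicTopology.Homotopy (locallyContractibleSpace_prod_addCircle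
  stronglyLocallyContractibleSpace_of_chartedSpace_normedSpace
  locallyContractibleSpace_of_chartedSpace_halfSpace)
open Literature.Topology.FourManifolds (RegularSublevel RegularSuperlevel IsRegularLevel
  BoundaryGluingData finRelHomology_of_compactSpace_halfSpace
  nonempty_preimage_Ici_homeomorph_regularSuperlevel nonempty_sublevel_homeomorph_prod_closedBall
  nonempty_level_homeomorph_prod_addCircle nonempty_boundary_regularSuperlevel_homeomorph_level)

/-- **`χ(Y ∖ ν°Σ) = χ(Y) - χ(Σ)` in tube coordinates** (Akhmedov–Park 2010, proof of Lemma 8,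
the summands "`e(Y₁(1,1)) - e(Σ₂)`", "`e(Z''(1,m)) - e(Σ̄₂)`").  For a closed smooth `4`-manifold
`Y`, a topological embedding `T : F × ℝ² → Y` of the product of a closed surface `F` with the
plane (an open tubular neighbourhood of `Σ = T(F × 0)` with trivial normal bundle) and a tube
function `g` (`Literature.Topology.FourManifolds.TubularSplitting`: regular level `¼`,
`{g ≤ ¼} = T(F × B̄(0, ½))`, `g ≡ 1` off the tube), the compact smooth manifold with boundary
`M = {¼ ≤ g}` (`RegularSuperlevel`, the complement of the open tube) has
`χ(M) = χ(Y) - χ(F)`: §6 for the cover `Y = {¼ ≤ g} ∪ {g ≤ ¼}` with `{g ≤ ¼} ≅ F × B̄`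
(`χ = χ(F)`, `FinRelHomology.prod_closedBall`) and `{g = ¼} ≅ F × S¹` (`χ = 0`).
[cite: AkhmedovPark2010, §9, proof of Lemma 8, "e(X₁(m)) = e(Y₁(1,1)) + e(Z''(1,m)) − 2e(Σ₂)"]
[cite: HatcherAT2002, §2.2 Thm. 2.44] -/
theorem relEuler_regularSuperlevel_tube_eq_sub
    {Y : Type} [TopologicalSpace Y] [T2Space Y] [CompactSpace Y]
    [ChartedSpace (EuclideanSpace ℝ (Fin 4)) Y] [IsManifold (𝓡 4) ∞ Y]
    {F : Type} [TopologicalSpace F] [T2Space F] [CompactSpace F]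
    [ChartedSpace (EuclideanSpace ℝ (Fin 2)) F]
    {T : F × EuclideanSpace ℝ (Fin 2) → Y} (hT : Topology.IsEmbedding T) {g : Y → ℝ}
    (hreg : IsRegularLevel (𝓡 4) g (1 / 4)) (hle : ∀ x, g (T x) ≤ 1 / 4 ↔ ‖x.2‖ ≤ 1 / 2)
    (hlt : ∀ x, g (T x) < 1 / 4 ↔ ‖x.2‖ < 1 / 2) (hout : ∀ y, y ∉ range T → g y = 1)
    (hF : FinRelHomology ℤ ℤ F ∅ 4) :
    relEuler ℤ ℤ (RegularSuperlevel hreg) ∅ = relEuler ℤ ℤ Y ∅ - relEuler ℤ ℤ F ∅ := by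
  haveI := stronglyLocallyContractibleSpace_of_chartedSpace_normedSpace (EuclideanSpace ℝ (Fin 2)) F
  have hg : Continuous g := hreg.contMDiff.continuous
  -- the cover `Y = {¼ ≤ g} ∪ {g ≤ ¼}`
  have hL₁ : IsCompact (g ⁻¹' Ici (1 / 4)) := (isClosed_Ici.preimage hg).isCompact
  have hL₂ : IsCompact (g ⁻¹' Iic (1 / 4)) := (isClosed_Iic.preimage hg).isCompact
  have hcov : g ⁻¹' Ici (1 / 4) ∪ g ⁻¹' Iic (1 / 4) = univ :=
    eq_univ_of_forall fun y => (le_total (1 / 4) (g y)).imp id id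
  have hint : g ⁻¹' Ici (1 / 4) ∩ g ⁻¹' Iic (1 / 4) = g ⁻¹' {1 / 4} := by
    ext y
    simp only [mem_inter_iff, mem_preimage, mem_Ici, mem_Iic, mem_singleton_iff]
    constructor
    · rintro ⟨h1, h2⟩; exact le_antisymm h2 h1
    · intro h; rw [h]; exact ⟨le_rfl, le_rfl⟩
  obtain ⟨φ₁⟩ := nonempty_preimage_Ici_homeomorph_regularSuperlevel hreg
  obtain ⟨φ₂⟩ := nonempty_sublevel_homeomorph_prod_closedBall hT hle hout
  obtain ⟨φ₀'⟩ := nonempty_level_homeomorph_prod_addCircle hT hle hlt hout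
  let φ₀ : ↥(g ⁻¹' Ici (1 / 4) ∩ g ⁻¹' Iic (1 / 4)) ≃ₜ F × AddCircle (1 : ℝ) :=
    (Homeomorph.setCongr hint).trans φ₀'
  -- local contractibility and finiteness of the three pieces
  have hP₁ : LocallyContractibleSpace (RegularSuperlevel hreg) :=
    locallyContractibleSpace_of_chartedSpace_halfSpace 4 (RegularSuperlevel hreg)
  haveI :=
    (convex_closedBall (0 : EuclideanSpace ℝ (Fin 2)) (1 / 2)).stronglyLocallyContractibleSpace
  have hP₂ : LocallyContractibleSpace
      (F × ↥(Metric.closedBall (0 : EuclideanSpace ℝ (Fin 2)) (1 / 2))) :=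
    StronglyLocallyContractibleSpace.locallyContractible
  have hP₀ : LocallyContractibleSpace (F × AddCircle (1 : ℝ)) :=
    locallyContractibleSpace_prod_addCircle F (one_ne_zero : (1 : ℝ) ≠ 0)
  have h₁ : FinRelHomology ℤ ℤ (RegularSuperlevel hreg) ∅ 5 :=
    finRelHomology_of_compactSpace_halfSpace (n := 3) (RegularSuperlevel hreg)
  obtain ⟨h₂', hχ₂⟩ := hF.prod_closedBall ℤ ℤ (E := EuclideanSpace ℝ (Fin 2))
    (show (0 : ℝ) ≤ 1 / 2 by norm_num)
  have h₂ : FinRelHomology ℤ ℤ (F × ↥(Metric.closedBall (0 : EuclideanSpace ℝ (Fin 2)) (1 / 2)))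
      ∅ 5 := h₂'.mono (by norm_num)
  obtain ⟨h₀, hχ₀⟩ := hF.prod_addCircle ℤ ℤ
  have hY := relEuler_eq_of_compact_cover hL₁ hL₂ hcov φ₁ φ₂ φ₀ hP₁ hP₂ hP₀ h₁ h₂ h₀
  rw [hχ₂, hχ₀, sub_zero] at hY
  omega

/-- **`e` is unchanged by regluing the tube piece (torus surgery), in tube coordinates**
(Akhmedov–Park 2010, §2 and §4: the torus surgeries do not change `e`; cf. §8
`relEuler_eq_of_torusSurgery_covers`).  For `Y`, `T`, `g` as in
`relEuler_regularSuperlevel_tube_eq_sub` and ANY closed topological `4`-manifold `P` which is a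
boundary gluing of the tube complement `M = {¼ ≤ g}` with the tube piece `N = {g ≤ ¼} ≅ F × D²`
along any identification of the boundaries, `e(P) = e(Y)`: §6 for the cover
`P = jA(M) ∪ jB(N)` (meeting in `jA(∂M) ≅ F × S¹`) gives `e(P) = e(M) + e(N) - 0` with
`e(N) = e(F)` (`FinRelHomology.prod_closedBall`) and `e(M) = e(Y) - e(F)`.
[cite: AkhmedovPark2010, §2 and §4] [cite: HatcherAT2002, §2.2 Thm. 2.44] -/
theorem relEuler_eq_of_tube_regluing
    {Y : Type} [TopologicalSpace Y] [T2Space Y] [CompactSpace Y]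
    [ChartedSpace (EuclideanSpace ℝ (Fin 4)) Y] [IsManifold (𝓡 4) ∞ Y]
    {F : Type} [TopologicalSpace F] [T2Space F] [CompactSpace F]
    [ChartedSpace (EuclideanSpace ℝ (Fin 2)) F]
    {T : F × EuclideanSpace ℝ (Fin 2) → Y} (hT : Topology.IsEmbedding T) {g : Y → ℝ}
    (hreg : IsRegularLevel (𝓡 4) g (1 / 4)) (hle : ∀ x, g (T x) ≤ 1 / 4 ↔ ‖x.2‖ ≤ 1 / 2)
    (hlt : ∀ x, g (T x) < 1 / 4 ↔ ‖x.2‖ < 1 / 2) (hout : ∀ y, y ∉ range T → g y = 1)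
    (hF : FinRelHomology ℤ ℤ F ∅ 4)
    {P : Type} [TopologicalSpace P] [T2Space P] [CompactSpace P]
    [ChartedSpace (EuclideanSpace ℝ (Fin 4)) P]
    {φ' : (RegularSublevel.boundaryData hreg.const_sub).carrier ≃
      (RegularSublevel.boundaryData hreg).carrier}
    (G : BoundaryGluingData (RegularSublevel.boundaryData hreg.const_sub)
      (RegularSublevel.boundaryData hreg) φ' P) :
    relEuler ℤ ℤ P ∅ = relEuler ℤ ℤ Y ∅ := by
  haveI := stronglyLocallyContractibleSpace_of_chartedSpace_normedSpace (EuclideanSpace ℝ (Fin 2)) F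
  have hA : Topology.IsEmbedding G.jA := G.isSmoothEmbedding_jA.isEmbedding
  have hB : Topology.IsEmbedding G.jB := G.isSmoothEmbedding_jB.isEmbedding
  have hK₁ : IsCompact (range G.jA) := isCompact_range hA.continuous
  have hK₂ : IsCompact (range G.jB) := isCompact_range hB.continuous
  let φ₁ : ↥(range G.jA) ≃ₜ RegularSuperlevel hreg := hA.toHomeomorph.symm
  let φ₂ : ↥(range G.jB) ≃ₜ RegularSublevel hreg := hB.toHomeomorph.symm
  -- the gluing region `jA(∂M) ≅ ∂M ≅ {g = ¼} ≅ F × S¹`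
  have hI : range G.jA ∩ range G.jB = G.jA '' ((𝓡∂ 4).boundary (RegularSuperlevel hreg)) := by
    ext p
    constructor
    · rintro ⟨⟨a, rfl⟩, ⟨b, hb⟩⟩
      obtain ⟨z, rfl, -⟩ := (G.jA_eq_jB_iff a b).1 hb.symm
      exact ⟨z.1, z.2, rfl⟩
    · rintro ⟨a, ha, rfl⟩
      refine ⟨mem_range_self a, ?_⟩
      exact ⟨(RegularSublevel.boundaryData hreg).incl (φ' ⟨a, ha⟩),
        ((G.jA_eq_jB_iff a _).2 ⟨⟨a, ha⟩, rfl, rfl⟩).symm⟩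
  have hembA : Topology.IsEmbedding (G.jA ∘ (Subtype.val :
      ↥((𝓡∂ 4).boundary (RegularSuperlevel hreg)) → RegularSuperlevel hreg)) :=
    hA.comp Topology.IsEmbedding.subtypeVal
  have hrangeA : range (G.jA ∘ (Subtype.val :
      ↥((𝓡∂ 4).boundary (RegularSuperlevel hreg)) → RegularSuperlevel hreg)) =
      G.jA '' ((𝓡∂ 4).boundary (RegularSuperlevel hreg)) := by
    rw [range_comp, Subtype.range_coe]
  obtain ⟨eB⟩ := nonempty_boundary_regularSuperlevel_homeomorph_level hreg
  obtain ⟨eL⟩ := nonempty_level_homeomorph_prod_addCircle hT hle hlt hout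
  let φ₀ : ↥(range G.jA ∩ range G.jB) ≃ₜ F × AddCircle (1 : ℝ) :=
    (Homeomorph.setCongr hI).trans
      ((hembA.toHomeomorph.trans (Homeomorph.setCongr hrangeA)).symm.trans (eB.trans eL))
  -- the pieces
  have hP₁ : LocallyContractibleSpace (RegularSuperlevel hreg) :=
    locallyContractibleSpace_of_chartedSpace_halfSpace 4 (RegularSuperlevel hreg)
  have hP₂ : LocallyContractibleSpace (RegularSublevel hreg) :=
    locallyContractibleSpace_of_chartedSpace_halfSpace 4 (RegularSublevel hreg)
  have hP₀ : LocallyContractibleSpace (F × AddCircle (1 : ℝ)) :=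
    locallyContractibleSpace_prod_addCircle F (one_ne_zero : (1 : ℝ) ≠ 0)
  have h₁ : FinRelHomology ℤ ℤ (RegularSuperlevel hreg) ∅ 5 :=
    finRelHomology_of_compactSpace_halfSpace (n := 3) (RegularSuperlevel hreg)
  have h₂ : FinRelHomology ℤ ℤ (RegularSublevel hreg) ∅ 5 :=
    finRelHomology_of_compactSpace_halfSpace (n := 3) (RegularSublevel hreg)
  obtain ⟨h₀, hχ₀⟩ := hF.prod_addCircle ℤ ℤ
  -- `e(N) = e(F)`: `N = {g ≤ ¼} ≅ F × B̄`
  obtain ⟨ψ₂⟩ := nonempty_sublevel_homeomorph_prod_closedBall hT hle hout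
  obtain ⟨-, hχB⟩ := hF.prod_closedBall ℤ ℤ (E := EuclideanSpace ℝ (Fin 2))
    (show (0 : ℝ) ≤ 1 / 2 by norm_num)
  have hχ₂ : relEuler ℤ ℤ (RegularSublevel hreg) ∅ = relEuler ℤ ℤ F ∅ := by
    rw [← hχB]
    have e₂ : RegularSublevel hreg ≃ₜ ↥(g ⁻¹' Iic (1 / 4)) := by
      unfold RegularSublevel; exact Homeomorph.refl _
    exact Literature.AlgebraicTopology.SingularHomology.relEuler_eq_of_homeomorph (R := ℤ) (M := ℤ)
      (A := (∅ : Set (RegularSublevel hreg))) (e₂.trans ψ₂) (fun _ hx => False.elim hx)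
      (fun _ hx => False.elim hx)
  have hM := relEuler_regularSuperlevel_tube_eq_sub hT hreg hle hlt hout hF
  have hP := relEuler_eq_of_compact_cover hK₁ hK₂ G.range_union φ₁ φ₂ φ₀ hP₁ hP₂ hP₀ h₁ h₂ h₀
  rw [hχ₂, hχ₀, sub_zero, hM] at hP
  omega

/-- **Akhmedov–Park 2010, proof of Lemma 8, step (a), in tube coordinates: `b₂(X₁(m)) = 3`.**
Let `Y₁`, `Y₂` be closed smooth `4`-manifolds with open tubular neighbourhoods
`Tᵢ : Fᵢ × ℝ² → Yᵢ` of surfaces with trivial normal bundle (closed surfaces `Fᵢ`, e.g.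
`Σ₂ ⊂ Y₁(1,1)` and `Σ̄₂ ⊂ Z''(1,m)`) and tube functions `gᵢ`, and let the closed simply connected topological
`4`-manifold `X` be a boundary gluing of the two tube complements `Mᵢ = {¼ ≤ gᵢ}` (the normal
connected sum `X₁(m) = Y₁(1,1) #_ψ Z''(1,m)`).  If
`(e(Y₁) - e(F₁)) + (e(Y₂) - e(F₂)) = 5` — the printed `(0 + 2) + (1 + 2)` — then
`rank H²(X; ℤ)/T = 3`: `X = jA(M₁) ∪ jB(M₂)` is a compact cover meeting in `jA(∂M₁) ≅ F₁ × S¹`,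
the pieces are locally contractible of finite homological type (compact manifolds with boundary,
`finRelHomology_of_compactSpace_halfSpace`), `χ(Mᵢ) = e(Yᵢ) - e(Fᵢ)`
(`relEuler_regularSuperlevel_tube_eq_sub`), and §7/§5 give `e(X) = 5`, `b₂ = e - 2 = 3`.
[cite: AkhmedovPark2010, §9, proof of Lemma 8, "e(X₁(m)) = 0 + 1 + 4 = 5"] -/
theorem akhmedovPark2010_lemma8_finrank_eq_three_of_tube_fibreSum
    {Y₁ : Type} [TopologicalSpace Y₁] [T2Space Y₁] [CompactSpace Y₁]
    [ChartedSpace (EuclideanSpace ℝ (Fin 4)) Y₁] [IsManifold (𝓡 4) ∞ Y₁]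
    {F₁ : Type} [TopologicalSpace F₁] [T2Space F₁] [CompactSpace F₁]
    [ChartedSpace (EuclideanSpace ℝ (Fin 2)) F₁]
    {T₁ : F₁ × EuclideanSpace ℝ (Fin 2) → Y₁} (hT₁ : Topology.IsEmbedding T₁) {g₁ : Y₁ → ℝ}
    (hreg₁ : IsRegularLevel (𝓡 4) g₁ (1 / 4)) (hle₁ : ∀ x, g₁ (T₁ x) ≤ 1 / 4 ↔ ‖x.2‖ ≤ 1 / 2)
    (hlt₁ : ∀ x, g₁ (T₁ x) < 1 / 4 ↔ ‖x.2‖ < 1 / 2) (hout₁ : ∀ y, y ∉ range T₁ → g₁ y = 1)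
    (hF₁ : FinRelHomology ℤ ℤ F₁ ∅ 4)
    {Y₂ : Type} [TopologicalSpace Y₂] [T2Space Y₂] [CompactSpace Y₂]
    [ChartedSpace (EuclideanSpace ℝ (Fin 4)) Y₂] [IsManifold (𝓡 4) ∞ Y₂]
    {F₂ : Type} [TopologicalSpace F₂] [T2Space F₂] [CompactSpace F₂]
    [ChartedSpace (EuclideanSpace ℝ (Fin 2)) F₂]
    {T₂ : F₂ × EuclideanSpace ℝ (Fin 2) → Y₂} (hT₂ : Topology.IsEmbedding T₂) {g₂ : Y₂ → ℝ}
    (hreg₂ : IsRegularLevel (𝓡 4) g₂ (1 / 4)) (hle₂ : ∀ x, g₂ (T₂ x) ≤ 1 / 4 ↔ ‖x.2‖ ≤ 1 / 2)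
    (hlt₂ : ∀ x, g₂ (T₂ x) < 1 / 4 ↔ ‖x.2‖ < 1 / 2) (hout₂ : ∀ y, y ∉ range T₂ → g₂ y = 1)
    (hF₂ : FinRelHomology ℤ ℤ F₂ ∅ 4)
    {X : Type} [TopologicalSpace X] [T2Space X] [CompactSpace X]
    [ChartedSpace (EuclideanSpace ℝ (Fin 4)) X] [SimplyConnectedSpace X]
    {ψ : (RegularSublevel.boundaryData hreg₁.const_sub).carrier ≃
      (RegularSublevel.boundaryData hreg₂.const_sub).carrier}
    (G : BoundaryGluingData (RegularSublevel.boundaryData hreg₁.const_sub)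
      (RegularSublevel.boundaryData hreg₂.const_sub) ψ X)
    (he : (relEuler ℤ ℤ Y₁ ∅ - relEuler ℤ ℤ F₁ ∅) + (relEuler ℤ ℤ Y₂ ∅ - relEuler ℤ ℤ F₂ ∅) = 5) :
    Module.finrank ℤ ↥(freeCohomology ℤ X 2) = 3 := by
  haveI :=
    stronglyLocallyContractibleSpace_of_chartedSpace_normedSpace (EuclideanSpace ℝ (Fin 2)) F₁
  have hA : Topology.IsEmbedding G.jA := G.isSmoothEmbedding_jA.isEmbedding
  have hB : Topology.IsEmbedding G.jB := G.isSmoothEmbedding_jB.isEmbedding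
  -- the compact cover `X = jA(M₁) ∪ jB(M₂)`
  have hK₁ : IsCompact (range G.jA) := isCompact_range hA.continuous
  have hK₂ : IsCompact (range G.jB) := isCompact_range hB.continuous
  let φ₁ : ↥(range G.jA) ≃ₜ RegularSuperlevel hreg₁ := hA.toHomeomorph.symm
  let φ₂ : ↥(range G.jB) ≃ₜ RegularSuperlevel hreg₂ := hB.toHomeomorph.symm
  -- the gluing region `jA(M₁) ∩ jB(M₂) = jA(∂M₁) ≅ ∂M₁ ≅ {g₁ = ¼} ≅ F₁ × S¹`
  have hI : range G.jA ∩ range G.jB = G.jA '' ((𝓡∂ 4).boundary (RegularSuperlevel hreg₁)) := by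
    ext p
    constructor
    · rintro ⟨⟨a, rfl⟩, ⟨b, hb⟩⟩
      obtain ⟨z, rfl, -⟩ := (G.jA_eq_jB_iff a b).1 hb.symm
      exact ⟨z.1, z.2, rfl⟩
    · rintro ⟨a, ha, rfl⟩
      refine ⟨mem_range_self a, ?_⟩
      exact ⟨(RegularSublevel.boundaryData hreg₂.const_sub).incl (ψ ⟨a, ha⟩),
        ((G.jA_eq_jB_iff a _).2 ⟨⟨a, ha⟩, rfl, rfl⟩).symm⟩
  have hembA : Topology.IsEmbedding (G.jA ∘ (Subtype.val :
      ↥((𝓡∂ 4).boundary (RegularSuperlevel hreg₁)) → RegularSuperlevel hreg₁)) :=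
    hA.comp Topology.IsEmbedding.subtypeVal
  have hrangeA : range (G.jA ∘ (Subtype.val :
      ↥((𝓡∂ 4).boundary (RegularSuperlevel hreg₁)) → RegularSuperlevel hreg₁)) =
      G.jA '' ((𝓡∂ 4).boundary (RegularSuperlevel hreg₁)) := by
    rw [range_comp, Subtype.range_coe]
  obtain ⟨eB⟩ := nonempty_boundary_regularSuperlevel_homeomorph_level hreg₁
  obtain ⟨eL⟩ := nonempty_level_homeomorph_prod_addCircle hT₁ hle₁ hlt₁ hout₁
  let φ₀ : ↥(range G.jA ∩ range G.jB) ≃ₜ F₁ × AddCircle (1 : ℝ) :=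
    (Homeomorph.setCongr hI).trans
      ((hembA.toHomeomorph.trans (Homeomorph.setCongr hrangeA)).symm.trans (eB.trans eL))
  -- local contractibility, finiteness, and the Euler characteristics of the pieces
  have hP₁ : LocallyContractibleSpace (RegularSuperlevel hreg₁) :=
    locallyContractibleSpace_of_chartedSpace_halfSpace 4 (RegularSuperlevel hreg₁)
  have hP₂ : LocallyContractibleSpace (RegularSuperlevel hreg₂) :=
    locallyContractibleSpace_of_chartedSpace_halfSpace 4 (RegularSuperlevel hreg₂)
  have h₁ : FinRelHomology ℤ ℤ (RegularSuperlevel hreg₁) ∅ 5 :=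
    finRelHomology_of_compactSpace_halfSpace (n := 3) (RegularSuperlevel hreg₁)
  have h₂ : FinRelHomology ℤ ℤ (RegularSuperlevel hreg₂) ∅ 5 :=
    finRelHomology_of_compactSpace_halfSpace (n := 3) (RegularSuperlevel hreg₂)
  have he₁ := relEuler_regularSuperlevel_tube_eq_sub hT₁ hreg₁ hle₁ hlt₁ hout₁ hF₁
  have he₂ := relEuler_regularSuperlevel_tube_eq_sub hT₂ hreg₂ hle₂ hlt₂ hout₂ hF₂
  refine akhmedovPark2010_lemma8_finrank_eq_three_of_cover_circle hK₁ hK₂ G.range_union φ₁ φ₂ φ₀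
    hP₁ hP₂ h₁ h₂ hF₁ ?_
  rw [he₁, he₂]
  exact he

end Tube

/-! ### §11 Step (a) assembled in tube coordinates: `σ = -1`; the leaf from tubes + a separating invariant -/

section TubeAssembly

open Literature.AlgebraicTopology.SingularHomology (singularHomology relEuler FinRelHomology)
open Literature.Topology.FourManifolds (RegularSublevel RegularSuperlevel IsRegularLevel
  BoundaryGluingData exists_signature_eq_add_of_tube_fibreSum
  isOrientableOver_int_four_of_simplyConnectedSpace)

/-- **`σ(X₁(m)) = -1` for a suitable orientation, in tube coordinates** (Akhmedov–Park 2010,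
proof of Lemma 8: "`σ(X₁(m)) = σ(Y₁(1,1)) + σ(Z''(1,m)) = 0 + (-1)`").  Let the closed smooth
`4`-manifold `X` be a boundary gluing of the tube complements of two tubes `Tᵢ : Fᵢ × ℝ² → Yᵢ`
(closed connected smooth `Yᵢ`, connected `Fᵢ`, tube functions `gᵢ`), where every orientation of
`Y₁` has signature `0` (e.g. `Y₁ = Σ₂ × T²` or a torus-surgered copy,
`Literature.Topology.FourManifolds.signature_prodCircle_eq_zero` with
`exists_signature_eq_of_tube_regluing`) and every orientation of `Y₂` has signature `±1`
(e.g. `T⁴ # ℂℙ²bar` and its torus-surgered copies).  Then some orientation of `X` has signature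
`-1` (`exists_signature_eq_add_of_tube_fibreSum` and `σ(X, -μ) = -σ(X, μ)`).
[cite: AkhmedovPark2010, §9, proof of Lemma 8, "σ(X₁(m)) = σ(Y₁(1,1)) + σ(Z''(1,m))"] -/
theorem exists_signature_eq_neg_one_of_tube_fibreSum
    {Y₁ : Type} [TopologicalSpace Y₁] [T2Space Y₁] [SecondCountableTopology Y₁] [CompactSpace Y₁]
    [ConnectedSpace Y₁] [ChartedSpace (EuclideanSpace ℝ (Fin 4)) Y₁] [IsManifold (𝓡 4) ∞ Y₁]
    {F₁ : Type} [TopologicalSpace F₁] [CompactSpace F₁] [ConnectedSpace F₁]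
    {T₁ : F₁ × EuclideanSpace ℝ (Fin 2) → Y₁} {g₁ : Y₁ → ℝ} (hT₁ : Topology.IsEmbedding T₁)
    (hreg₁ : IsRegularLevel (𝓡 4) g₁ (1 / 4)) (hle₁ : ∀ x, g₁ (T₁ x) ≤ 1 / 4 ↔ ‖x.2‖ ≤ 1 / 2)
    (hlt₁ : ∀ x, g₁ (T₁ x) < 1 / 4 ↔ ‖x.2‖ < 1 / 2) (hout₁ : ∀ y, y ∉ range T₁ → g₁ y = 1)
    {Y₂ : Type} [TopologicalSpace Y₂] [T2Space Y₂] [SecondCountableTopology Y₂] [CompactSpace Y₂]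
    [ConnectedSpace Y₂] [ChartedSpace (EuclideanSpace ℝ (Fin 4)) Y₂] [IsManifold (𝓡 4) ∞ Y₂]
    {F₂ : Type} [TopologicalSpace F₂] [CompactSpace F₂] [ConnectedSpace F₂]
    {T₂ : F₂ × EuclideanSpace ℝ (Fin 2) → Y₂} {g₂ : Y₂ → ℝ} (hT₂ : Topology.IsEmbedding T₂)
    (hreg₂ : IsRegularLevel (𝓡 4) g₂ (1 / 4)) (hle₂ : ∀ x, g₂ (T₂ x) ≤ 1 / 4 ↔ ‖x.2‖ ≤ 1 / 2)
    (hlt₂ : ∀ x, g₂ (T₂ x) < 1 / 4 ↔ ‖x.2‖ < 1 / 2) (hout₂ : ∀ y, y ∉ range T₂ → g₂ y = 1)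
    {X : Type} [TopologicalSpace X] [T2Space X] [CompactSpace X]
    [ChartedSpace (EuclideanSpace ℝ (Fin 4)) X] [IsManifold (𝓡 4) ∞ X]
    {ψ : (RegularSublevel.boundaryData hreg₁.const_sub).carrier ≃
      (RegularSublevel.boundaryData hreg₂.const_sub).carrier}
    (G : BoundaryGluingData (RegularSublevel.boundaryData hreg₁.const_sub)
      (RegularSublevel.boundaryData hreg₂.const_sub) ψ X)
    (hσ₁ : ∀ ν : HomologicalOrientation ℤ Y₁ 4, ν.signature = 0)
    (hσ₂ : ∀ ν : HomologicalOrientation ℤ Y₂ 4, ν.signature = -1 ∨ ν.signature = 1)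
    (μ₁ : HomologicalOrientation ℤ Y₁ 4) (μ₂ : HomologicalOrientation ℤ Y₂ 4)
    (μ : HomologicalOrientation ℤ X 4) :
    ∃ μ' : HomologicalOrientation ℤ X 4, μ'.signature = -1 := by
  obtain ⟨μ₁', μ₂', h⟩ := exists_signature_eq_add_of_tube_fibreSum hT₁ hreg₁ hle₁ hlt₁ hout₁ hT₂
    hreg₂ hle₂ hlt₂ hout₂ G μ₁ μ₂ μ
  rw [hσ₁ μ₁', zero_add] at h
  rcases hσ₂ μ₂' with h2 | h2
  · exact ⟨μ, by rw [h, h2]⟩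
  · refine ⟨-μ, ?_⟩
    rw [HomologicalOrientation.signature_neg_holds μ, h, h2]

/-- **Lemma 8 from tubes, numbers and a separating invariant** — the printed proof of
Akhmedov–Park 2010, Lemma 8, with steps (a) (both `e` and `σ`, §§5–§11), (b) (`π₁ = 1`, here the
hypothesis `SimplyConnectedSpace`, dischargeable by §3) and (d) ⇒ Lemma (§4) chained: a family
`X m` of closed simply connected smooth `4`-manifolds, each a boundary gluing of the tube
complements of two tubes `T₁ m : F₁ m × ℝ² → Y₁ m`, `T₂ m : F₂ m × ℝ² → Y₂ m` (closed connected
smooth `Yᵢ m`, closed connected surfaces `Fᵢ m`) with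
`(e(Y₁ m) - e(F₁ m)) + (e(Y₂ m) - e(F₂ m)) = 5`, all orientations of `Y₁ m` of signature `0` and of
`Y₂ m` of signature `±1` (each `X m` is `ℤ`-orientable, being simply connected:
`isOrientableOver_int_four_of_simplyConnectedSpace`), together with a diffeomorphism invariant `SW`
taking infinitely many values on the family, proves `akhmedovPark2010_lemma8_invariants`.  What is
NOT supplied here is exactly what the printed proof takes from §§2–4 of the paper and from
Seiberg–Witten theory: the tubes in `Σ₂ × T²` and `T⁴ # ℂℙ²bar` (and their torus-surgered
copies), the numbers `e`, `σ` of these two blocks (in the tree), orientability, `π₁ = 1`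
(§1–§3 from the presentations), and the values of `SW`. [cite: AkhmedovPark2010, §9, Lemma 8 and its proof] -/
theorem akhmedovPark2010_lemma8_invariants_of_tube_fibreSums {ι : Type}
    -- the first tubes
    (Y₁ : ι → Type) [∀ m, TopologicalSpace (Y₁ m)] [∀ m, T2Space (Y₁ m)]
    [∀ m, SecondCountableTopology (Y₁ m)] [∀ m, CompactSpace (Y₁ m)] [∀ m, ConnectedSpace (Y₁ m)]
    [∀ m, ChartedSpace (EuclideanSpace ℝ (Fin 4)) (Y₁ m)] [∀ m, IsManifold (𝓡 4) ∞ (Y₁ m)]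
    (F₁ : ι → Type) [∀ m, TopologicalSpace (F₁ m)] [∀ m, T2Space (F₁ m)] [∀ m, CompactSpace (F₁ m)]
    [∀ m, ConnectedSpace (F₁ m)] [∀ m, ChartedSpace (EuclideanSpace ℝ (Fin 2)) (F₁ m)]
    (T₁ : ∀ m, F₁ m × EuclideanSpace ℝ (Fin 2) → Y₁ m) (hT₁ : ∀ m, Topology.IsEmbedding (T₁ m))
    (g₁ : ∀ m, Y₁ m → ℝ) (hreg₁ : ∀ m, IsRegularLevel (𝓡 4) (g₁ m) (1 / 4))
    (hle₁ : ∀ m x, g₁ m (T₁ m x) ≤ 1 / 4 ↔ ‖x.2‖ ≤ 1 / 2)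
    (hlt₁ : ∀ m x, g₁ m (T₁ m x) < 1 / 4 ↔ ‖x.2‖ < 1 / 2)
    (hout₁ : ∀ m y, y ∉ range (T₁ m) → g₁ m y = 1) (hF₁ : ∀ m, FinRelHomology ℤ ℤ (F₁ m) ∅ 4)
    -- the second tubes
    (Y₂ : ι → Type) [∀ m, TopologicalSpace (Y₂ m)] [∀ m, T2Space (Y₂ m)]
    [∀ m, SecondCountableTopology (Y₂ m)] [∀ m, CompactSpace (Y₂ m)] [∀ m, ConnectedSpace (Y₂ m)]
    [∀ m, ChartedSpace (EuclideanSpace ℝ (Fin 4)) (Y₂ m)] [∀ m, IsManifold (𝓡 4) ∞ (Y₂ m)]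
    (F₂ : ι → Type) [∀ m, TopologicalSpace (F₂ m)] [∀ m, T2Space (F₂ m)] [∀ m, CompactSpace (F₂ m)]
    [∀ m, ConnectedSpace (F₂ m)] [∀ m, ChartedSpace (EuclideanSpace ℝ (Fin 2)) (F₂ m)]
    (T₂ : ∀ m, F₂ m × EuclideanSpace ℝ (Fin 2) → Y₂ m) (hT₂ : ∀ m, Topology.IsEmbedding (T₂ m))
    (g₂ : ∀ m, Y₂ m → ℝ) (hreg₂ : ∀ m, IsRegularLevel (𝓡 4) (g₂ m) (1 / 4))
    (hle₂ : ∀ m x, g₂ m (T₂ m x) ≤ 1 / 4 ↔ ‖x.2‖ ≤ 1 / 2)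
    (hlt₂ : ∀ m x, g₂ m (T₂ m x) < 1 / 4 ↔ ‖x.2‖ < 1 / 2)
    (hout₂ : ∀ m y, y ∉ range (T₂ m) → g₂ m y = 1) (hF₂ : ∀ m, FinRelHomology ℤ ℤ (F₂ m) ∅ 4)
    -- the fibre sums
    (X : ι → Type) [∀ m, TopologicalSpace (X m)] [∀ m, T2Space (X m)]
    [∀ m, SecondCountableTopology (X m)] [∀ m, ChartedSpace (EuclideanSpace ℝ (Fin 4)) (X m)]
    [∀ m, IsManifold (𝓡 4) ∞ (X m)] [∀ m, CompactSpace (X m)] [∀ m, SimplyConnectedSpace (X m)]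
    (ψ : ∀ m, (RegularSublevel.boundaryData (hreg₁ m).const_sub).carrier ≃
      (RegularSublevel.boundaryData (hreg₂ m).const_sub).carrier)
    (G : ∀ m, BoundaryGluingData (RegularSublevel.boundaryData (hreg₁ m).const_sub)
      (RegularSublevel.boundaryData (hreg₂ m).const_sub) (ψ m) (X m))
    -- the numbers of the blocks, orientability
    (he : ∀ m, (relEuler ℤ ℤ (Y₁ m) ∅ - relEuler ℤ ℤ (F₁ m) ∅) +
      (relEuler ℤ ℤ (Y₂ m) ∅ - relEuler ℤ ℤ (F₂ m) ∅) = 5)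
    (hσ₁ : ∀ m (ν : HomologicalOrientation ℤ (Y₁ m) 4), ν.signature = 0)
    (hσ₂ : ∀ m (ν : HomologicalOrientation ℤ (Y₂ m) 4), ν.signature = -1 ∨ ν.signature = 1)
    (μ₁ : ∀ m, HomologicalOrientation ℤ (Y₁ m) 4) (μ₂ : ∀ m, HomologicalOrientation ℤ (Y₂ m) 4)
    -- the separating diffeomorphism invariant
    {V : Type*} (SW : ι → V) (hSW : ∀ i j, Nonempty (X i ≃ₘ⟮𝓡 4, 𝓡 4⟯ X j) → SW i = SW j)
    (hinf : (range SW).Infinite) :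
    akhmedovPark2010_lemma8_invariants := by
  have hσ : ∀ m, ∃ μ' : HomologicalOrientation ℤ (X m) 4, μ'.signature = -1 := fun m => by
    -- simply connected manifolds are `ℤ`-orientable (Hatcher Prop. 3.25)
    obtain ⟨μ⟩ := isOrientableOver_int_four_of_simplyConnectedSpace (X := X m)
    exact exists_signature_eq_neg_one_of_tube_fibreSum (hT₁ m) (hreg₁ m) (hle₁ m) (hlt₁ m)
      (hout₁ m) (hT₂ m) (hreg₂ m) (hle₂ m) (hlt₂ m) (hout₂ m) (G m) (hσ₁ m) (hσ₂ m) (μ₁ m) (μ₂ m) μ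
  choose μ' hμ' using hσ
  refine akhmedovPark2010_lemma8_invariants_of_infinite_range' X μ' (fun m => ⟨?_, hμ' m⟩) SW hSW
    hinf
  exact akhmedovPark2010_lemma8_finrank_eq_three_of_tube_fibreSum (hT₁ m) (hreg₁ m) (hle₁ m)
    (hlt₁ m) (hout₁ m) (hF₁ m) (hT₂ m) (hreg₂ m) (hle₂ m) (hlt₂ m) (hout₂ m) (hF₂ m) (G m) (he m)

end TubeAssembly

end Literature.Barriers.SmoothPoincare4

end
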